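import Literature.Probability.Process.ProgressiveDensity
import Literature.Probability.Process.ItoFormulaCore
import Literature.Analysis.FunctionSpaces.ItoProcesses
import HarnessLib

/-!
# Localisation of the Itô integral: existence for progressive `L²_loc` integrands

Discharge of the named fact `Literature.Probability.Process.exists_isItoIntegral` (`ItoCalculus.lean`): every integrand `H`
which is progressively measurable for the *raw* natural filtration of the canonical Brownian
motion `B = Literature.brownian` and satisfies `∫₀ᵗ H² ds < ∞` a.s. for every `t` has an Itô integral
`J = ∫ H dB` in the sense of `Literature.Probability.Process.IsItoIntegral` (`J 0 = 0`, a.s. continuous paths, local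
martingale, u.c.p. limit of the elementary integrals along every approximating sequence of
bounded simple processes). The square-integrable case is
`Literature.Probability.Process.exists_isItoIntegral_of_sq_integrable` (`ProgressiveDensity.lean`); this file is the
localisation, organised so that no usual conditions are needed:

* `Literature.sqEnergy H s ω = ∫₀ˢ H(ω)² dr ∈ [0, ∞]` and its **finite-energy part**
  `Ĥ = Literature.finiteEnergyPart H` (`H` until the first rational time of infinite energy, then `0`):
  `Ĥ = H` on almost every path, `Ĥ` is progressive, and `s ↦ ∫₀ˢ Ĥ² dr` is continuous in
  `[0, ∞]` on *every* path (`tendsto_sqEnergy_finiteEnergyPart`, `sqEnergy_le_of_forall_lt`);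
* hence the energy levels `Tₘ = inf {t : ∫₀ᵗ Ĥ² ≥ m}` (Mathlib's `hittingAfter` of the level set
  `[m, ∞]`) are stopping times of the raw filtration (`isStoppingTime_hittingAfter_Ici`:
  `{Tₘ ≤ t} = {m ≤ ∫₀ᵗ Ĥ²}`), and `Tₘ ↑ ∞` a.s.;
* the cut integrands `Ĥ 𝟙_{[0,Tₘ]}` (`Literature.Analysis.FunctionSpaces.cutIntegrand`) are progressive with energy `≤ m`, so
  they have square-integrable martingale integrals `Iᵐ`;
* a diagonal sequence `Lₖ` of fine bounded simple approximants of `Ĥ`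
  (`exists_diag_simpleProcess`) has elementary integrals Cauchy uniformly on compacts in
  probability (basic estimate `measure_sup_integral_sub_ge_le_brownian`); their u.c.p. limit,
  progressively regularised (`dyadicReg`), is the integral `J`;
* **simple processes cut at a stopping time** (`Literature.Probability.Process.SimpleProcess.cut`, values `Hᵢ 𝟙_{tᵢ < T}`)
  have the elementary integrals of `Lₖ` up to `T` and approximate `Ĥ 𝟙_{[0,T]}`; comparing at
  time `t` costs one partition cell, controlled by the modulus of continuity of `B` in
  probability — whence `J_{t ∧ Tₘ} = Iᵐ_t` a.s. (`stoppedProcess_ae_eq_of_tendstoUCP`), and the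
  stopped process `J^{Tₘ}`, adapted by progressivity, is a martingale as a modification of `Iᵐ`.

Main results: `Literature.Analysis.FunctionSpaces.exists_isItoIntegral_finiteEnergyPart`, `Literature.Analysis.FunctionSpaces.exists_isItoIntegral_holds`.

## References

* K. Itô, *Stochastic integral*, Proc. Imp. Acad. Tokyo 20 (1944), 519–524.
* D. Revuz, M. Yor, *Continuous Martingales and Brownian Motion* (3rd ed., 1999), Ch. IV,
  Thm (2.2), Def. (2.6), Prop. (2.7) (localisation along `Tₙ = inf {t : ∫₀ᵗ K² d⟨M⟩ ≥ n}`),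
  Def. (2.9), Prop. (2.10) (`K 1_{[0,T]} · M = (K · M)^T`), Thm (2.12), Prop. (2.13).
* O. Kallenberg, *Foundations of Modern Probability* (2nd ed., 2002), Ch. 17 (raw filtrations,
  Lemma 7.8 on versions).
-/

open MeasureTheory ProbabilityTheory Filter Finset
open scoped NNReal ENNReal Topology

noncomputable section

namespace Literature.Analysis.FunctionSpaces

section SimpleProcess
open Literature.Probability.Process (SimpleProcess)
open Literature.Probability.Process.SimpleProcess

variable {Ω : Type*} {m : MeasurableSpace Ω} {𝓕 : Filtration ℝ≥0 m}

/-- **A simple process cut at a stopping time** `τ` of the raw filtration: same (deterministic)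
partition, and on `(tᵢ, tᵢ₊₁]` the value `Hᵢ 𝟙_{tᵢ < τ}` — still `𝓕 tᵢ`-measurable, so this is
again a bounded simple process. Its elementary integral agrees with that of `H` up to time `τ`
(`integral_cut_of_le`) and its step process approximates `H 𝟙_{[0, τ]}` up to one partition
cell (`lintegral_toProcess_cut_sub_sq_le`); this is the elementary form of
`K 1_{[0,T]} · M = (K · M)^T`.
Revuz–Yor, *Continuous Martingales and Brownian Motion* (1999), Ch. IV, Prop. (2.5) and
Prop. (2.10)(ii). [folklore] -/
def _root_.Literature.Probability.Process.SimpleProcess.cut (L : SimpleProcess m 𝓕) (τ : Ω → WithTop ℝ≥0) (hτ : IsStoppingTime 𝓕 τ) :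
    SimpleProcess m 𝓕 where
  times := L.times
  sorted := L.sorted
  value i := {ω | ((L.time i : ℝ≥0) : WithTop ℝ≥0) < τ ω}.indicator (L.value i)
  measurable i hi := by
    have heq : L.times.get ⟨i, hi⟩ = L.time i := by
      rw [L.time_eq_getElem hi]; rfl
    rw [heq]
    refine (L.stronglyMeasurable_value hi).indicator ?_
    have hset : {ω | ((L.time i : ℝ≥0) : WithTop ℝ≥0) < τ ω} =
        {ω | τ ω ≤ ((L.time i : ℝ≥0) : WithTop ℝ≥0)}ᶜ := by
      ext ω; simp only [Set.mem_setOf_eq, Set.mem_compl_iff, not_le]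
    rw [hset]
    exact (hτ (L.time i)).compl
  bounded := by
    obtain ⟨C, hC⟩ := L.bounded
    refine ⟨C, fun i ω ↦ ?_⟩
    by_cases h : ω ∈ {ω | ((L.time i : ℝ≥0) : WithTop ℝ≥0) < τ ω}
    · rw [Set.indicator_of_mem h]; exact hC i ω
    · rw [Set.indicator_of_notMem h, abs_zero]; exact (abs_nonneg _).trans (hC i ω)

section Cut

variable (L : SimpleProcess m 𝓕) (τ : Ω → WithTop ℝ≥0) (hτ : IsStoppingTime 𝓕 τ)

/-- Cutting keeps the partition. [folklore] -/
@[simp] theorem _root_.Literature.Probability.Process.SimpleProcess.cut_times : (L.cut τ hτ).times = L.times := rfl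

/-- Cutting keeps the partition times (total reading). [folklore] -/
@[simp] theorem _root_.Literature.Probability.Process.SimpleProcess.cut_time (i : ℕ) : (L.cut τ hτ).time i = L.time i := rfl

/-- The values of the cut process: `Hᵢ` on `{tᵢ < τ}`, `0` elsewhere. [folklore] -/
theorem _root_.Literature.Probability.Process.SimpleProcess.cut_value_apply (i : ℕ) (ω : Ω) :
    (L.cut τ hτ).value i ω =
      if ((L.time i : ℝ≥0) : WithTop ℝ≥0) < τ ω then L.value i ω else 0 := by
  show ({ω | ((L.time i : ℝ≥0) : WithTop ℝ≥0) < τ ω}.indicator (L.value i)) ω = _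
  simp only [Set.indicator_apply, Set.mem_setOf_eq]

/-- The values of the cut process obey the bound of `L` (or `0`). [folklore] -/
theorem _root_.Literature.Probability.Process.SimpleProcess.abs_cut_value_le {C : ℝ} (hC : ∀ i ω, |L.value i ω| ≤ C) (i : ℕ) (ω : Ω) :
    |(L.cut τ hτ).value i ω| ≤ max C 0 := by
  rw [cut_value_apply]
  split_ifs
  · exact (hC i ω).trans (le_max_left _ _)
  · rw [abs_zero]; exact le_max_right _ _

/-- The step process of the cut process is bounded by the bound of `L` (or `0`). [folklore] -/
theorem _root_.Literature.Probability.Process.SimpleProcess.abs_toProcess_cut_le {C : ℝ} (hC : ∀ i ω, |L.value i ω| ≤ C) (s : ℝ≥0) (ω : Ω) :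
    |(L.cut τ hτ).toProcess s ω| ≤ max C 0 := by
  have h := (L.cut τ hτ).abs_toProcess_le (L.abs_cut_value_le τ hτ hC) s ω
  rwa [max_eq_left (le_max_right C 0)] at h

/-- **Up to the stopping time the cut process has the elementary integrals of `L`**:
`((L cut τ) · B)ₛ = (L · B)ₛ` for `s ≤ τ`. [folklore] -/
theorem _root_.Literature.Probability.Process.SimpleProcess.integral_cut_of_le (B : ℝ≥0 → Ω → ℝ) {s : ℝ≥0} {ω : Ω}
    (hs : ((s : ℝ≥0) : WithTop ℝ≥0) ≤ τ ω) :
    (L.cut τ hτ).integral B s ω = L.integral B s ω := by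
  unfold SimpleProcess.integral
  simp only [cut_times, cut_time]
  refine sum_congr rfl fun i hi ↦ ?_
  have hi' : i + 1 < L.times.length := by have := mem_range.1 hi; omega
  rw [cut_value_apply]
  split_ifs with h
  · rfl
  · -- `τ ≤ tᵢ`, so `s ≤ tᵢ ≤ tᵢ₊₁` and the Brownian increment vanishes
    have hsi : s ≤ L.time i := by
      have : τ ω ≤ ((L.time i : ℝ≥0) : WithTop ℝ≥0) := not_lt.1 h
      exact_mod_cast hs.trans this
    rw [min_eq_left (hsi.trans (L.time_mono (Nat.le_succ i) hi')), min_eq_left hsi, sub_self,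
      mul_zero, mul_zero]

/-- Up to the stopping time the cut process has the step process of `L`. [folklore] -/
theorem _root_.Literature.Probability.Process.SimpleProcess.toProcess_cut_of_le {s : ℝ≥0} {ω : Ω} (hs : ((s : ℝ≥0) : WithTop ℝ≥0) ≤ τ ω) :
    (L.cut τ hτ).toProcess s ω = L.toProcess s ω := by
  unfold toProcess
  simp only [cut_times, cut_time]
  refine sum_congr rfl fun i _ ↦ ?_
  by_cases hsI : s ∈ Set.Ioc (L.time i) (L.time (i + 1))
  · rw [Set.indicator_of_mem hsI, Set.indicator_of_mem hsI, cut_value_apply, if_pos]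
    exact lt_of_lt_of_le (by exact_mod_cast hsI.1) hs
  · rw [Set.indicator_of_notMem hsI, Set.indicator_of_notMem hsI]

/-- **One cell after the stopping time the cut process vanishes**: if `τ(ω) = r`, every capped
cell `t ∧ tᵢ₊₁ - t ∧ tᵢ` has length `≤ δ` and `r + δ < s ≤ t`, then the step process of the cut
process vanishes at `s`. [folklore] -/
theorem _root_.Literature.Probability.Process.SimpleProcess.toProcess_cut_eq_zero {ω : Ω} {r : ℝ≥0} (hr : τ ω = r) (t : ℝ≥0) {s : ℝ≥0} (hst : s ≤ t)
    {δ : ℝ} (hmesh : ∀ i, i + 1 < L.times.length →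
      (((min t (L.time (i + 1))) : ℝ≥0) : ℝ) - (min t (L.time i) : ℝ≥0) ≤ δ)
    (hδ : (r : ℝ) + δ < s) : (L.cut τ hτ).toProcess s ω = 0 := by
  unfold toProcess
  simp only [cut_times, cut_time]
  refine sum_eq_zero fun i hi ↦ ?_
  have hi' : i + 1 < L.times.length := by have := mem_range.1 hi; omega
  by_cases hsI : s ∈ Set.Ioc (L.time i) (L.time (i + 1))
  · rw [Set.indicator_of_mem hsI, cut_value_apply, if_neg]
    intro hlt
    rw [hr] at hlt
    have hri : L.time i < r := by exact_mod_cast hlt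
    -- `r, s ∈ (tᵢ, tᵢ₊₁]` and `s ≤ t`: `s - r ≤` the capped cell
    have h1 : (s : ℝ) ≤ (min t (L.time (i + 1)) : ℝ≥0) := by
      exact_mod_cast le_min hst hsI.2
    have h2 : ((min t (L.time i) : ℝ≥0) : ℝ) ≤ r := by
      exact_mod_cast (min_le_right _ _).trans hri.le
    have h3 := hmesh i hi'
    linarith
  · rw [Set.indicator_of_notMem hsI]

/-- **Stopping the cut process costs at most one cell**: if `τ(ω) = r`, `|Lᵢ| ≤ C`, every capped
cell of `[0, t]` has length `≤ δ`, and the path of `B` oscillates by at most `θ` over `δ` on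
`[0, t]`, then `|((L cut τ) · B)ₜ - ((L cut τ) · B)_{t ∧ r}| ≤ C θ` (only the cell straddling `r`
contributes). [folklore] -/
theorem _root_.Literature.Probability.Process.SimpleProcess.abs_integral_cut_sub_le (B : ℝ≥0 → Ω → ℝ) {C : ℝ} (hC : ∀ i ω, |L.value i ω| ≤ C)
    (hC0 : 0 ≤ C) {ω : Ω} {r : ℝ≥0} (hr : τ ω = r) (t : ℝ≥0) {δ θ : ℝ} (hθ : 0 ≤ θ)
    (hmesh : ∀ i, i + 1 < L.times.length →
      (((min t (L.time (i + 1))) : ℝ≥0) : ℝ) - (min t (L.time i) : ℝ≥0) ≤ δ)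
    (hB : ∀ u ≤ t, ∀ v ≤ t, |(u : ℝ) - v| ≤ δ → |B u ω - B v ω| ≤ θ) :
    |(L.cut τ hτ).integral B t ω - (L.cut τ hτ).integral B (min t r) ω| ≤ C * θ := by
  set c := L.cut τ hτ with hc
  -- the terms of the difference
  set F : ℕ → ℝ := fun i ↦ c.value i ω *
    ((B (min t (L.time (i + 1))) ω - B (min t (L.time i)) ω) -
      (B (min (min t r) (L.time (i + 1))) ω - B (min (min t r) (L.time i)) ω)) with hF
  have hdiff : c.integral B t ω - c.integral B (min t r) ω =
      ∑ i ∈ range (L.times.length - 1), F i := by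
    unfold SimpleProcess.integral
    simp only [hc, hF, cut_times, cut_time, ← sum_sub_distrib, mul_sub]
  -- the straddling cells
  set S := (range (L.times.length - 1)).filter (fun i ↦ L.time i < r ∧ r < L.time (i + 1)) with hS
  have hzero : ∀ i ∈ range (L.times.length - 1), i ∉ S → F i = 0 := by
    intro i hi hiS
    have hi' : i + 1 < L.times.length := by have := mem_range.1 hi; omega
    simp only [hS, mem_filter, not_and, not_lt] at hiS
    simp only [hF]
    by_cases h1 : L.time i < r
    · -- `tᵢ₊₁ ≤ r`: the two increments agree
      have h2 : L.time (i + 1) ≤ r := hiS hi h1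
      have e1 : min (min t r) (L.time (i + 1)) = min t (L.time (i + 1)) := by
        rw [min_assoc, min_eq_right h2]
      have e2 : min (min t r) (L.time i) = min t (L.time i) := by
        rw [min_assoc, min_eq_right (h1.le)]
      rw [e1, e2, sub_self, mul_zero]
    · -- `r ≤ tᵢ`: the cut value vanishes
      have : c.value i ω = 0 := by
        rw [hc, cut_value_apply, if_neg]
        rw [hr]; exact_mod_cast h1
      rw [this, zero_mul]
  have hsum : c.integral B t ω - c.integral B (min t r) ω = ∑ i ∈ S, F i := by
    rw [hdiff, hS, sum_filter]
    refine sum_congr rfl fun i hi ↦ ?_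
    split_ifs with h
    · rfl
    · exact hzero i hi (by simpa [hS, mem_filter, hi] using h)
  -- at most one straddling cell
  have hcard : S.card ≤ 1 := by
    refine Finset.card_le_one.2 fun i hi j hj ↦ ?_
    simp only [hS, mem_filter, mem_range] at hi hj
    by_contra hij
    exact L.not_mem_Ioc_of_mem_Ioc (by omega) (by omega) hij ⟨hj.2.1, hj.2.2.le⟩
      ⟨hi.2.1, hi.2.2.le⟩
  -- each straddling term is `≤ C θ`
  have hterm : ∀ i ∈ S, |F i| ≤ C * θ := by
    intro i hi
    simp only [hS, mem_filter, mem_range] at hi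
    obtain ⟨hi0, h1, h2⟩ := hi
    have hi' : i + 1 < L.times.length := by omega
    have e1 : min (min t r) (L.time (i + 1)) = min t r := by
      rw [min_assoc, min_eq_left h2.le]
    have e2 : min (min t r) (L.time i) = min t (L.time i) := by
      rw [min_assoc, min_eq_right h1.le]
    simp only [hF]
    rw [e1, e2, abs_mul]
    have hv : |c.value i ω| ≤ C := by
      have := L.abs_cut_value_le τ hτ hC i ω
      rwa [max_eq_left hC0] at this
    have hincr : |B (min t (L.time (i + 1))) ω - B (min t (L.time i)) ω -
        (B (min t r) ω - B (min t (L.time i)) ω)| ≤ θ := by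
      have : B (min t (L.time (i + 1))) ω - B (min t (L.time i)) ω -
          (B (min t r) ω - B (min t (L.time i)) ω) =
          B (min t (L.time (i + 1))) ω - B (min t r) ω := by ring
      rw [this]
      refine hB _ (min_le_left _ _) _ (min_le_left _ _) ?_
      have hlo : ((min t (L.time i) : ℝ≥0) : ℝ) ≤ (min t r : ℝ≥0) := by
        exact_mod_cast min_le_min_left t h1.le
      have hhi : ((min t r : ℝ≥0) : ℝ) ≤ (min t (L.time (i + 1)) : ℝ≥0) := by
        exact_mod_cast min_le_min_left t h2.le
      have h3 := hmesh i hi'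
      rw [abs_of_nonneg (by linarith)]
      linarith
    exact mul_le_mul hv hincr (abs_nonneg _) hC0
  rw [hsum]
  calc |∑ i ∈ S, F i| ≤ ∑ i ∈ S, |F i| := abs_sum_le_sum_abs _ _
    _ ≤ ∑ i ∈ S, C * θ := sum_le_sum hterm
    _ = S.card * (C * θ) := by rw [sum_const, nsmul_eq_mul]
    _ ≤ 1 * (C * θ) := by gcongr; exact_mod_cast hcard
    _ = C * θ := one_mul _

/-- **The cut process approximates the cut integrand up to one cell**: with
`G = Ĥ 𝟙_{[0, τ]}`, every capped cell of `[0, t]` of length `≤ δ` and `|Lᵢ| ≤ C`,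
`∫₀ᵗ ((L cut τ) - G)² ds ≤ ∫₀ᵗ (L - Ĥ)² ds + (C ∨ 0)² δ`. [folklore] -/
theorem _root_.Literature.Probability.Process.SimpleProcess.lintegral_toProcess_cut_sub_sq_le (Hh : ℝ≥0 → Ω → ℝ) {C : ℝ}
    (hC : ∀ i ω, |L.value i ω| ≤ C) (ω : Ω) (t : ℝ≥0) {δ : ℝ}
    (hmesh : ∀ i, i + 1 < L.times.length →
      (((min t (L.time (i + 1))) : ℝ≥0) : ℝ) - (min t (L.time i) : ℝ≥0) ≤ δ) :
    ∫⁻ s in Set.Icc (0 : ℝ) t, ENNReal.ofReal (((L.cut τ hτ).toProcess s.toNNReal ω -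
        {ω' | ((s.toNNReal : ℝ≥0) : WithTop ℝ≥0) ≤ τ ω'}.indicator (Hh s.toNNReal) ω) ^ 2) ≤
      (∫⁻ s in Set.Icc (0 : ℝ) t,
          ENNReal.ofReal ((L.toProcess s.toNNReal ω - Hh s.toNNReal ω) ^ 2)) +
        ENNReal.ofReal ((max C 0) ^ 2 * δ) := by
  set c := L.cut τ hτ with hc
  -- the error term: `(C ∨ 0)²` on the cell `(r, r + δ]` after `τ = r`
  set h : ℝ → ℝ≥0∞ := fun s ↦ match τ ω with
    | ⊤ => 0
    | (r : ℝ≥0) => (Set.Ioc (r : ℝ) (r + δ)).indicator (fun _ ↦ ENNReal.ofReal ((max C 0) ^ 2)) s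
    with hh
  have hhm : Measurable h := by
    rw [hh]
    cases τ ω with
    | top => exact measurable_const
    | coe r => exact measurable_const.indicator measurableSet_Ioc
  have hhint : ∫⁻ s in Set.Icc (0 : ℝ) t, h s ≤ ENNReal.ofReal ((max C 0) ^ 2 * δ) := by
    rw [hh]
    cases τ ω with
    | top => simp
    | coe r =>
      simp only
      rw [lintegral_indicator_const measurableSet_Ioc, Measure.restrict_apply measurableSet_Ioc,
        ENNReal.ofReal_mul (sq_nonneg _)]
      gcongr
      calc volume (Set.Ioc (r : ℝ) (r + δ) ∩ Set.Icc 0 t) ≤ volume (Set.Ioc (r : ℝ) (r + δ)) :=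
            measure_mono Set.inter_subset_left
        _ = ENNReal.ofReal δ := by rw [Real.volume_Ioc]; ring_nf
  -- pointwise comparison on `[0, t]`
  have hpt : ∀ s ∈ Set.Icc (0 : ℝ) t,
      ENNReal.ofReal ((c.toProcess s.toNNReal ω -
        {ω' | ((s.toNNReal : ℝ≥0) : WithTop ℝ≥0) ≤ τ ω'}.indicator (Hh s.toNNReal) ω) ^ 2) ≤
      ENNReal.ofReal ((L.toProcess s.toNNReal ω - Hh s.toNNReal ω) ^ 2) + h s := by
    intro s hs
    by_cases hle : ((s.toNNReal : ℝ≥0) : WithTop ℝ≥0) ≤ τ ω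
    · rw [Set.indicator_of_mem (show ω ∈ {ω' | ((s.toNNReal : ℝ≥0) : WithTop ℝ≥0) ≤ τ ω'}
        from hle), hc, L.toProcess_cut_of_le τ hτ hle]
      exact le_self_add
    · rw [Set.indicator_of_notMem (show ω ∉ {ω' | ((s.toNNReal : ℝ≥0) : WithTop ℝ≥0) ≤ τ ω'}
        from hle), sub_zero]
      -- `τ ω = r < s`
      have hτtop : τ ω ≠ ⊤ := fun htop ↦ hle (htop ▸ le_top)
      obtain ⟨r, hr⟩ := WithTop.ne_top_iff_exists.1 hτtop
      have hrs : r < s.toNNReal := by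
        have : τ ω < ((s.toNNReal : ℝ≥0) : WithTop ℝ≥0) := not_le.1 hle
        rw [← hr] at this; exact_mod_cast this
      have hs0 : (s.toNNReal : ℝ) = s := Real.coe_toNNReal _ hs.1
      have hst : s.toNNReal ≤ t := Real.toNNReal_le_iff_le_coe.2 hs.2
      by_cases hfar : (r : ℝ) + δ < s
      · -- beyond the straddling cell: the cut step process vanishes
        have h0 : c.toProcess s.toNNReal ω = 0 :=
          L.toProcess_cut_eq_zero τ hτ hr.symm t hst hmesh (by rwa [hs0])
        rw [h0]; simp
      · -- in the straddling cell: bounded by `(C ∨ 0)²`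
        have hmem : s ∈ Set.Ioc (r : ℝ) (r + δ) := by
          refine ⟨?_, not_lt.1 hfar⟩
          have : (r : ℝ) < (s.toNNReal : ℝ) := by exact_mod_cast hrs
          rwa [hs0] at this
        have hhs : h s = ENNReal.ofReal ((max C 0) ^ 2) := by
          rw [hh]; simp only [← hr, Set.indicator_of_mem hmem]
        calc ENNReal.ofReal ((c.toProcess s.toNNReal ω) ^ 2)
            ≤ ENNReal.ofReal ((max C 0) ^ 2) := by
              refine ENNReal.ofReal_le_ofReal ?_
              have hb : |c.toProcess s.toNNReal ω| ≤ max C 0 :=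
                L.abs_toProcess_cut_le τ hτ hC s.toNNReal ω
              rw [← sq_abs]
              exact pow_le_pow_left₀ (abs_nonneg _) hb 2
          _ = h s := hhs.symm
          _ ≤ _ := le_add_self
  calc ∫⁻ s in Set.Icc (0 : ℝ) t, ENNReal.ofReal ((c.toProcess s.toNNReal ω -
          {ω' | ((s.toNNReal : ℝ≥0) : WithTop ℝ≥0) ≤ τ ω'}.indicator (Hh s.toNNReal) ω) ^ 2)
      ≤ ∫⁻ s in Set.Icc (0 : ℝ) t,
          (ENNReal.ofReal ((L.toProcess s.toNNReal ω - Hh s.toNNReal ω) ^ 2) + h s) :=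
        setLIntegral_mono' measurableSet_Icc hpt
    _ = (∫⁻ s in Set.Icc (0 : ℝ) t,
          ENNReal.ofReal ((L.toProcess s.toNNReal ω - Hh s.toNNReal ω) ^ 2)) +
          ∫⁻ s in Set.Icc (0 : ℝ) t, h s := lintegral_add_right _ hhm
    _ ≤ _ := by gcongr

end Cut

end SimpleProcess


variable {Ω : Type*} {m : MeasurableSpace Ω} {𝓕 : Filtration ℝ≥0 m}

/-! ### The sqEnergy `∫₀ˢ H² dr` of an integrand -/

/-- The **sqEnergy** `∫₀ˢ H(r)² dr ∈ [0, ∞]` of the path `r ↦ H_r(ω)` on `[0, s]` (extended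
Lebesgue integral in real time; the increasing process `∫₀ H² d⟨B⟩` of Revuz–Yor for `⟨B⟩ₜ = t`).
Revuz–Yor, *Continuous Martingales and Brownian Motion* (1999), Ch. IV, Def. (2.6) and the
remark following it. [folklore] -/
def sqEnergy (H : ℝ≥0 → Ω → ℝ) (s : ℝ≥0) (ω : Ω) : ℝ≥0∞ :=
  ∫⁻ r in Set.Icc (0 : ℝ) s, ENNReal.ofReal (H r.toNNReal ω ^ 2)

section Energy

variable (H : ℝ≥0 → Ω → ℝ)

/-- The sqEnergy as the `H²`-weighted Lebesgue measure of `[0, s]`. [folklore] -/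
theorem sqEnergy_eq_withDensity (s : ℝ≥0) (ω : Ω) :
    sqEnergy H s ω = ((volume : Measure ℝ).withDensity
      fun r : ℝ ↦ ENNReal.ofReal (H r.toNNReal ω ^ 2)) (Set.Icc (0 : ℝ) s) :=
  (withDensity_apply _ measurableSet_Icc).symm

/-- The sqEnergy vanishes at time `0`. [folklore] -/
@[simp] theorem sqEnergy_zero (ω : Ω) : sqEnergy H 0 ω = 0 := by
  unfold sqEnergy
  rw [NNReal.coe_zero, Set.Icc_self]
  exact setLIntegral_measure_zero _ _ (by simp)

/-- The sqEnergy is nondecreasing in time. [folklore] -/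
theorem sqEnergy_mono (ω : Ω) : Monotone fun s ↦ sqEnergy H s ω := fun _ _ h ↦
  lintegral_mono_set (Set.Icc_subset_Icc le_rfl (NNReal.coe_le_coe.2 h))

/-- Splitting the sqEnergy at an intermediate time. [folklore] -/
theorem sqEnergy_add_lintegral_Ioc {s s' : ℝ≥0} (h : s ≤ s') (ω : Ω) :
    sqEnergy H s' ω = sqEnergy H s ω +
      ∫⁻ r in Set.Ioc (s : ℝ) s', ENNReal.ofReal (H r.toNNReal ω ^ 2) := by
  unfold sqEnergy
  have hdisj : Disjoint (Set.Icc (0 : ℝ) s) (Set.Ioc (s : ℝ) s') :=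
    Set.disjoint_left.2 fun _ hr hr' ↦ (not_lt.2 (Set.mem_Icc.1 hr).2) (Set.mem_Ioc.1 hr').1
  have key := lintegral_union (μ := (volume : Measure ℝ))
    (f := fun r : ℝ ↦ ENNReal.ofReal (H r.toNNReal ω ^ 2)) measurableSet_Ioc hdisj
  rw [Set.Icc_union_Ioc_eq_Icc (NNReal.coe_nonneg s) (NNReal.coe_le_coe.2 h)] at key
  exact key

/-- A pointwise smaller integrand has smaller sqEnergy. [folklore] -/
theorem sqEnergy_mono_fun {G H : ℝ≥0 → Ω → ℝ} {ω : Ω} (h : ∀ s, G s ω ^ 2 ≤ H s ω ^ 2) (s : ℝ≥0) :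
    sqEnergy G s ω ≤ sqEnergy H s ω :=
  lintegral_mono fun _ ↦ ENNReal.ofReal_le_ofReal (h _)

/-- Paths with the same values have the same sqEnergy. [folklore] -/
theorem sqEnergy_congr {G H : ℝ≥0 → Ω → ℝ} {ω : Ω} (h : ∀ s, G s ω = H s ω) (s : ℝ≥0) :
    sqEnergy G s ω = sqEnergy H s ω := by
  unfold sqEnergy; simp_rw [h]

/-- **Left-continuity of the sqEnergy** (at every path and time): if `sqEnergy H r ω ≤ c` for all
`r < T` then `sqEnergy H T ω ≤ c` (continuity from below of the weighted Lebesgue measure;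
points are null). [folklore] -/
theorem sqEnergy_le_of_forall_lt {T : ℝ≥0} {c : ℝ≥0∞} {ω : Ω}
    (h : ∀ r < T, sqEnergy H r ω ≤ c) : sqEnergy H T ω ≤ c := by
  by_cases hT0 : T = 0
  · subst hT0; simp
  have hT : 0 < T := pos_iff_ne_zero.2 hT0
  set ν := (volume : Measure ℝ).withDensity fun r : ℝ ↦ ENNReal.ofReal (H r.toNNReal ω ^ 2)
    with hν
  have hac : ν ≪ volume := withDensity_absolutelyContinuous _ _
  -- `[0, T] = ⋃ₙ [0, T - 1/(n+1)]` up to the null point `T`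
  let a : ℕ → ℝ := fun n ↦ (T : ℝ) - 1 / ((n : ℝ) + 1)
  have hmono : Monotone fun n ↦ Set.Icc (0 : ℝ) (a n) := by
    intro n n' hnn'
    refine Set.Icc_subset_Icc le_rfl ?_
    simp only [a]
    gcongr
  have hU : Set.Icc (0 : ℝ) T = (⋃ n, Set.Icc (0 : ℝ) (a n)) ∪ {(T : ℝ)} := by
    ext x
    simp only [Set.mem_Icc, Set.mem_union, Set.mem_iUnion, Set.mem_singleton_iff, a]
    constructor
    · rintro ⟨hx0, hxT⟩
      rcases hxT.lt_or_eq with hlt | heq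
      · obtain ⟨n, hn⟩ := exists_nat_one_div_lt (sub_pos.2 hlt)
        exact Or.inl ⟨n, hx0, by linarith⟩
      · exact Or.inr heq
    · rintro (⟨n, hx0, hxn⟩ | rfl)
      · refine ⟨hx0, hxn.trans ?_⟩
        have : (0 : ℝ) < 1 / ((n : ℝ) + 1) := by positivity
        linarith
      · exact ⟨T.2, le_rfl⟩
  have hlim : Tendsto (fun n ↦ ν (Set.Icc (0 : ℝ) (a n))) atTop
      (𝓝 (ν (⋃ n, Set.Icc (0 : ℝ) (a n)))) := tendsto_measure_iUnion_atTop hmono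
  have hle : ∀ n, ν (Set.Icc (0 : ℝ) (a n)) ≤ c := by
    intro n
    have hn : (0 : ℝ) < 1 / ((n : ℝ) + 1) := by positivity
    rcases lt_or_ge (a n) 0 with hneg | hnonneg
    · rw [Set.Icc_eq_empty (not_le.2 hneg), measure_empty]; exact zero_le
    · have hr : (a n).toNNReal < T := by
        rw [← NNReal.coe_lt_coe, Real.coe_toNNReal _ hnonneg]
        simp only [a]; linarith
      have := h _ hr
      rwa [sqEnergy_eq_withDensity, Real.coe_toNNReal _ hnonneg] at this
  calc sqEnergy H T ω = ν (Set.Icc (0 : ℝ) T) := sqEnergy_eq_withDensity H T ω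
    _ ≤ ν (⋃ n, Set.Icc (0 : ℝ) (a n)) + ν {(T : ℝ)} := by rw [hU]; exact measure_union_le _ _
    _ = ν (⋃ n, Set.Icc (0 : ℝ) (a n)) := by rw [hac (Real.volume_singleton), add_zero]
    _ ≤ c := le_of_tendsto' hlim hle

/-- **Right-continuity of the sqEnergy where it is finite to the right**: if
`sqEnergy H (T + δ) ω < ∞` for some `δ > 0`, then `sqEnergy H (T + 1/(n+1)) ω → sqEnergy H T ω`.
[folklore] -/
theorem tendsto_sqEnergy_add_of_lt_top {T δ : ℝ≥0} {ω : Ω} (hδ : 0 < δ)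
    (hfin : sqEnergy H (T + δ) ω < ∞) :
    Tendsto (fun n : ℕ ↦ sqEnergy H (T + 1 / ((n : ℝ≥0) + 1)) ω) atTop (𝓝 (sqEnergy H T ω)) := by
  set ν := (volume : Measure ℝ).withDensity fun r : ℝ ↦ ENNReal.ofReal (H r.toNNReal ω ^ 2)
    with hν
  have hanti : Antitone fun n : ℕ ↦ Set.Icc (0 : ℝ) ((T : ℝ) + 1 / ((n : ℝ) + 1)) := by
    intro n n' hnn'
    refine Set.Icc_subset_Icc le_rfl ?_
    gcongr
  have hI : Set.Icc (0 : ℝ) T = ⋂ n : ℕ, Set.Icc (0 : ℝ) ((T : ℝ) + 1 / ((n : ℝ) + 1)) := by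
    ext x
    simp only [Set.mem_Icc, Set.mem_iInter]
    constructor
    · rintro ⟨hx0, hxT⟩ n
      exact ⟨hx0, hxT.trans (le_add_of_nonneg_right (by positivity))⟩
    · intro hx
      refine ⟨(hx 0).1, le_of_forall_pos_lt_add fun ε hε ↦ ?_⟩
      obtain ⟨n, hn⟩ := exists_nat_one_div_lt hε
      linarith [(hx n).2]
  obtain ⟨n₀, hn₀⟩ := exists_nat_one_div_lt (NNReal.coe_pos.2 hδ)
  have hfin' : ∃ n : ℕ, ν (Set.Icc (0 : ℝ) ((T : ℝ) + 1 / ((n : ℝ) + 1))) ≠ ∞ := by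
    refine ⟨n₀, ne_top_of_le_ne_top hfin.ne ?_⟩
    rw [sqEnergy_eq_withDensity]
    refine measure_mono (Set.Icc_subset_Icc le_rfl ?_)
    push_cast; linarith
  have hlim := tendsto_measure_iInter_atTop (μ := ν)
    (fun n : ℕ ↦ (measurableSet_Icc :
      MeasurableSet (Set.Icc (0 : ℝ) ((T : ℝ) + 1 / ((n : ℝ) + 1)))).nullMeasurableSet)
    hanti hfin'
  rw [← hI] at hlim
  have heq : ∀ n : ℕ, sqEnergy H (T + 1 / ((n : ℝ≥0) + 1)) ω =
      ν (Set.Icc (0 : ℝ) ((T : ℝ) + 1 / ((n : ℝ) + 1))) := by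
    intro n
    rw [sqEnergy_eq_withDensity]
    push_cast; rfl
  simp_rw [heq, sqEnergy_eq_withDensity]
  exact hlim

/-- **The sqEnergy of a progressive integrand is adapted**: `ω ↦ ∫₀ˢ H² dr` is
`𝓕 s`-measurable (Fubini measurability on `Ω × ℝ` with the σ-algebra `𝓕 s ⊗ 𝓑`).
Revuz–Yor, *Continuous Martingales and Brownian Motion* (1999), Ch. I, Prop. (4.8) and Ch. IV,
Prop. (2.7). [folklore] -/
theorem measurable_sqEnergy {H : ℝ≥0 → Ω → ℝ} (hH : IsStronglyProgressive 𝓕 H) (s : ℝ≥0) :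
    Measurable[𝓕 s] (sqEnergy H s) := by
  letI mΩ : MeasurableSpace Ω := 𝓕 s
  have hF : Measurable (fun q : Ω × ℝ ↦ ENNReal.ofReal (H (min q.2.toNNReal s) q.1 ^ 2)) := by
    have h1 : Measurable (fun q : Ω × ℝ ↦
        ((⟨min q.2.toNNReal s, Set.mem_Iic.2 (min_le_right _ _)⟩, q.1) : Set.Iic s × Ω)) :=
      ((measurable_real_toNNReal.comp measurable_snd).min measurable_const).subtype_mk.prodMk
        measurable_fst
    exact (((hH s).measurable.comp h1).pow_const 2).ennreal_ofReal
  have hint := hF.lintegral_prod_right' (ν := (volume : Measure ℝ).restrict (Set.Icc (0 : ℝ) s))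
  have heq : sqEnergy H s = fun ω ↦ ∫⁻ r in Set.Icc (0 : ℝ) s,
      ENNReal.ofReal (H (min r.toNNReal s) ω ^ 2) := by
    funext ω
    refine setLIntegral_congr_fun measurableSet_Icc (fun r hr ↦ ?_)
    rw [min_eq_left (Real.toNNReal_le_iff_le_coe.2 hr.2)]
  rw [heq]
  exact hint

/-- **Locally square-integrable paths have finite sqEnergy**: if for every `t`,
`∫₀ᵗ H² ds < ∞` a.s. (as `IntegrableOn`), then a.s. all energies `∫₀ⁿ H² ds`, `n ∈ ℕ`, are
finite. [folklore] -/
theorem ae_forall_sqEnergy_lt_top {P : Measure Ω} {H : ℝ≥0 → Ω → ℝ}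
    (hint : ∀ t : ℝ≥0, ∀ᵐ ω ∂P, IntegrableOn (fun s : ℝ ↦ H s.toNNReal ω ^ 2) (Set.Icc 0 t)) :
    ∀ᵐ ω ∂P, ∀ n : ℕ, sqEnergy H n ω < ∞ := by
  rw [ae_all_iff]
  intro n
  filter_upwards [hint n] with ω hω
  exact (hasFiniteIntegral_iff_ofReal (ae_of_all _ fun s ↦ sq_nonneg _)).1 hω.hasFiniteIntegral

end Energy

/-! ### The finite-sqEnergy part of an integrand -/

/-- The set of `(s, ω)` before which all rational-time energies of `H` are finite. [folklore] -/
def finiteEnergySet (H : ℝ≥0 → Ω → ℝ) : Set (ℝ≥0 × Ω) :=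
  {p | ∀ q : ℚ, 0 ≤ q → (q : ℝ) < p.1 → sqEnergy H (q : ℝ).toNNReal p.2 < ∞}

/-- The **finite-sqEnergy part** `Ĥ` of an integrand `H`: `Ĥ_s(ω) = H_s(ω)` as long as
`∫₀^q H(ω)² dr < ∞` for every rational `q < s`, and `0` from the first time the sqEnergy of the
path is infinite on. For paths of locally finite sqEnergy (almost every path of an integrand in
`L²_loc`), `Ĥ = H`; but the sqEnergy of `Ĥ` is a *continuous* `[0, ∞]`-valued function of time on
*every* path, which makes its level-hitting times stopping times of the raw filtration.
Revuz–Yor, *Continuous Martingales and Brownian Motion* (1999), Ch. IV, Def. (2.6) and the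
localisation in the proof of Prop. (2.7) / Def. (2.9). [folklore] -/
def finiteEnergyPart (H : ℝ≥0 → Ω → ℝ) : ℝ≥0 → Ω → ℝ :=
  fun s ω ↦ (finiteEnergySet H).indicator (fun p ↦ H p.1 p.2) (s, ω)

section FiniteEnergyPart

variable (H : ℝ≥0 → Ω → ℝ)

open scoped Classical in
/-- Unfolding of the finite-sqEnergy part. [folklore] -/
theorem finiteEnergyPart_apply (s : ℝ≥0) (ω : Ω) :
    finiteEnergyPart H s ω = if (s, ω) ∈ finiteEnergySet H then H s ω else 0 := by
  simp only [finiteEnergyPart, Set.indicator_apply]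

/-- The finite-sqEnergy part is pointwise `H` or `0`; in particular `Ĥ² ≤ H²`. [folklore] -/
theorem finiteEnergyPart_sq_le (s : ℝ≥0) (ω : Ω) :
    finiteEnergyPart H s ω ^ 2 ≤ H s ω ^ 2 := by
  rw [finiteEnergyPart_apply]
  split_ifs
  · exact le_rfl
  · rw [zero_pow two_ne_zero]; exact sq_nonneg _

/-- **On paths of locally finite sqEnergy the finite-sqEnergy part is the whole integrand.**
[folklore] -/
theorem finiteEnergyPart_eq_of_forall {ω : Ω} (hω : ∀ n : ℕ, sqEnergy H n ω < ∞) (s : ℝ≥0) :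
    finiteEnergyPart H s ω = H s ω := by
  rw [finiteEnergyPart_apply, if_pos]
  intro q hq _
  exact lt_of_le_of_lt (sqEnergy_mono H ω (Nat.le_ceil _)) (hω _)

/-- After a rational time of infinite sqEnergy the finite-sqEnergy part vanishes. [folklore] -/
theorem finiteEnergyPart_eq_zero {ω : Ω} {q : ℚ} (hq : 0 ≤ q)
    (hinf : sqEnergy H (q : ℝ).toNNReal ω = ∞) {s : ℝ≥0} (hqs : (q : ℝ) < s) :
    finiteEnergyPart H s ω = 0 := by
  rw [finiteEnergyPart_apply, if_neg]
  intro h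
  exact (h q hq hqs).ne hinf

/-- **The finite-sqEnergy part of a progressive integrand is progressive** (the defining event
before time `i` involves only the `𝓕 q`-measurable energies at rational times `q ≤ i`).
[folklore] -/
theorem isStronglyProgressive_finiteEnergyPart {H : ℝ≥0 → Ω → ℝ}
    (hH : IsStronglyProgressive 𝓕 H) : IsStronglyProgressive 𝓕 (finiteEnergyPart H) := by
  intro i
  -- the defining set, restricted to `Set.Iic i × Ω`
  have hset : MeasurableSet[Subtype.instMeasurableSpace.prod (𝓕 i)]
      {p : Set.Iic i × Ω | ((p.1 : ℝ≥0), p.2) ∈ finiteEnergySet H} := by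
    have heq : {p : Set.Iic i × Ω | ((p.1 : ℝ≥0), p.2) ∈ finiteEnergySet H} =
        ⋂ q : ℚ, {p : Set.Iic i × Ω | 0 ≤ q → (q : ℝ) < (p.1 : ℝ≥0) →
          sqEnergy H (q : ℝ).toNNReal p.2 < ∞} := by
      ext p; simp only [finiteEnergySet, Set.mem_setOf_eq, Set.mem_iInter]
    rw [heq]
    refine MeasurableSet.iInter fun q ↦ ?_
    by_cases hq : 0 ≤ q
    · by_cases hqi : (q : ℝ).toNNReal ≤ i
      · -- `q ≤ i`: the sqEnergy at `q` is `𝓕 q ≤ 𝓕 i`-measurable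
        have h1 : MeasurableSet[Subtype.instMeasurableSpace.prod (𝓕 i)]
            {p : Set.Iic i × Ω | ((p.1 : ℝ≥0) : ℝ) ≤ q} := by
          have hm : Measurable[Subtype.instMeasurableSpace.prod (𝓕 i)]
              (fun p : Set.Iic i × Ω ↦ ((p.1 : ℝ≥0) : ℝ)) :=
            measurable_coe_nnreal_real.comp
              ((@measurable_subtype_coe _ _ (Set.Iic i)).comp (@measurable_fst _ _ _ (𝓕 i)))
          exact @measurableSet_le _ _ _ _ _ (Subtype.instMeasurableSpace.prod (𝓕 i)) _ _ _ _ _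
            hm (@measurable_const _ _ _ (Subtype.instMeasurableSpace.prod (𝓕 i)) _)
        have h2 : MeasurableSet[Subtype.instMeasurableSpace.prod (𝓕 i)]
            {p : Set.Iic i × Ω | sqEnergy H (q : ℝ).toNNReal p.2 < ∞} := by
          have hm : Measurable[𝓕 i] (sqEnergy H (q : ℝ).toNNReal) :=
            (measurable_sqEnergy hH _).mono (𝓕.mono hqi) le_rfl
          have : Measurable[Subtype.instMeasurableSpace.prod (𝓕 i), 𝓕 i]
              (fun p : Set.Iic i × Ω ↦ p.2) := @measurable_snd _ _ _ (𝓕 i)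
          exact (hm.comp this) measurableSet_Iio
        have heq' : {p : Set.Iic i × Ω | 0 ≤ q → (q : ℝ) < (p.1 : ℝ≥0) →
            sqEnergy H (q : ℝ).toNNReal p.2 < ∞} =
            {p : Set.Iic i × Ω | ((p.1 : ℝ≥0) : ℝ) ≤ q} ∪
              {p : Set.Iic i × Ω | sqEnergy H (q : ℝ).toNNReal p.2 < ∞} := by
          ext p
          simp only [Set.mem_setOf_eq, Set.mem_union, hq, forall_true_left]
          constructor
          · intro h
            by_cases hle : ((p.1 : ℝ≥0) : ℝ) ≤ q
            · exact Or.inl hle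
            · exact Or.inr (h (not_le.1 hle))
          · rintro (h | h) hlt
            · exact absurd hlt (not_lt.2 h)
            · exact h
        rw [heq']
        exact h1.union h2
      · -- `i < q`: the condition `q < p.1 ≤ i` is void
        have heq' : {p : Set.Iic i × Ω | 0 ≤ q → (q : ℝ) < (p.1 : ℝ≥0) →
            sqEnergy H (q : ℝ).toNNReal p.2 < ∞} = Set.univ := by
          refine Set.eq_univ_of_forall fun p _ hlt ↦ absurd hlt (not_lt.2 ?_)
          have hpi : ((p.1 : ℝ≥0) : ℝ) ≤ i := NNReal.coe_le_coe.2 p.1.2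
          have hiq : (i : ℝ) < (q : ℝ) := by
            have := not_le.1 hqi
            rw [← NNReal.coe_lt_coe, Real.coe_toNNReal _ (by exact_mod_cast hq)] at this
            exact this
          linarith
        rw [heq']; exact MeasurableSet.univ
    · have heq' : {p : Set.Iic i × Ω | 0 ≤ q → (q : ℝ) < (p.1 : ℝ≥0) →
          sqEnergy H (q : ℝ).toNNReal p.2 < ∞} = Set.univ :=
        Set.eq_univ_of_forall fun p h0 ↦ absurd h0 hq
      rw [heq']; exact MeasurableSet.univ
  have hfun : (fun p : Set.Iic i × Ω ↦ finiteEnergyPart H p.1 p.2) =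
      {p : Set.Iic i × Ω | ((p.1 : ℝ≥0), p.2) ∈ finiteEnergySet H}.indicator
        fun p ↦ H p.1 p.2 := by
    funext p
    classical
    simp only [finiteEnergyPart, Set.indicator_apply, Set.mem_setOf_eq]
  rw [hfun]
  exact (hH i).indicator hset

/-- **The sqEnergy of the finite-sqEnergy part is right-continuous at every path and time**:
`sqEnergy Ĥ (T + 1/(n+1)) ω → sqEnergy Ĥ T ω`. Either some sqEnergy to the right of `T` is finite
(continuity from above), or all rational-time energies of `H` beyond `T` are infinite, in which
case `Ĥ` vanishes after `T` and its sqEnergy is constant there. [folklore] -/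
theorem tendsto_sqEnergy_finiteEnergyPart (ω : Ω) (T : ℝ≥0) :
    Tendsto (fun n : ℕ ↦ sqEnergy (finiteEnergyPart H) (T + 1 / ((n : ℝ≥0) + 1)) ω) atTop
      (𝓝 (sqEnergy (finiteEnergyPart H) T ω)) := by
  by_cases hfin : ∃ n : ℕ, sqEnergy (finiteEnergyPart H) (T + 1 / ((n : ℝ≥0) + 1)) ω < ∞
  · obtain ⟨n, hn⟩ := hfin
    exact tendsto_sqEnergy_add_of_lt_top _ (by positivity) hn
  · push Not at hfin
    simp only [top_le_iff] at hfin
    -- all energies to the right are infinite; we show the sqEnergy at `T` is infinite too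
    suffices hT : sqEnergy (finiteEnergyPart H) T ω = ∞ by
      rw [hT]; simp_rw [hfin]; exact tendsto_const_nhds
    by_contra hT
    by_cases hrat : ∃ q : ℚ, (T : ℝ) < q ∧ sqEnergy H (q : ℝ).toNNReal ω < ∞
    · -- some rational time beyond `T` has finite `H`-sqEnergy: contradiction with `hfin`
      obtain ⟨q, hTq, hq⟩ := hrat
      obtain ⟨n, hn⟩ := exists_nat_one_div_lt (sub_pos.2 hTq)
      have hle : T + 1 / ((n : ℝ≥0) + 1) ≤ (q : ℝ).toNNReal := by
        rw [← NNReal.coe_le_coe, Real.coe_toNNReal _ (T.2.trans hTq.le)]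
        push_cast; linarith
      have h1 : sqEnergy (finiteEnergyPart H) (T + 1 / ((n : ℝ≥0) + 1)) ω ≤
          sqEnergy H (q : ℝ).toNNReal ω :=
        (sqEnergy_mono_fun (fun s ↦ finiteEnergyPart_sq_le H s ω) _).trans (sqEnergy_mono H ω hle)
      rw [hfin n, top_le_iff] at h1
      exact hq.ne h1
    · -- all rational times beyond `T` have infinite `H`-sqEnergy: `Ĥ = 0` after `T`
      push Not at hrat
      have hzero : ∀ s : ℝ≥0, T < s → finiteEnergyPart H s ω = 0 := by
        intro s hTs
        obtain ⟨q, hTq, hqs⟩ := exists_rat_btwn (NNReal.coe_lt_coe.2 hTs)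
        have hq0 : (0 : ℝ) ≤ q := T.2.trans hTq.le
        exact finiteEnergyPart_eq_zero H (by exact_mod_cast hq0)
          (top_le_iff.1 (hrat q hTq)) hqs
      have hconst : sqEnergy (finiteEnergyPart H) (T + 1 / (((0 : ℕ) : ℝ≥0) + 1)) ω =
          sqEnergy (finiteEnergyPart H) T ω := by
        rw [Nat.cast_zero,
          sqEnergy_add_lintegral_Ioc _ (le_add_of_nonneg_right (by positivity)),
          setLIntegral_congr_fun measurableSet_Ioc (g := fun _ ↦ 0), lintegral_zero, add_zero]
        intro r hr
        have hTr : T < r.toNNReal := by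
          rw [← NNReal.coe_lt_coe, Real.coe_toNNReal _ (T.2.trans hr.1.le)]; exact hr.1
        simp [hzero _ hTr]
      exact hT (hconst ▸ hfin 0)

end FiniteEnergyPart

/-! ### Level-hitting times of a right-continuous increasing family -/

section HitLevel

variable {E : ℝ≥0 → Ω → ℝ≥0∞} {c : ℝ≥0∞} {ω : Ω}

open scoped Classical in
/-- Unfolding of the **first time the level `c` is reached** by the `[0, ∞]`-valued family
`E s ω` — Mathlib's `hittingAfter E (Set.Ici c) ⊥` (`⊤` if never); for the energy of the
finite-energy part these are the localising times `Tₙ = inf {t : ∫₀ᵗ H² ds ≥ n}`.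
Revuz–Yor, *Continuous Martingales and Brownian Motion* (1999), Ch. IV, Def. (2.6) and the
proof of Prop. (2.7). [folklore] -/
theorem hittingAfter_Ici_bot_apply (E : ℝ≥0 → Ω → ℝ≥0∞) (c : ℝ≥0∞) (ω : Ω) :
    hittingAfter E (Set.Ici c) ⊥ ω =
      if ∃ s, c ≤ E s ω then ((sInf {s | c ≤ E s ω} : ℝ≥0) : WithTop ℝ≥0) else ⊤ := by
  simp [hittingAfter]

/-- **Hitting before `t` means the level is reached at `t`**, for a family which is monotone
and right-continuous in time (in the form: `c ≤ E (T + 1/(n+1))` for all `n` forces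
`c ≤ E T`). [folklore] -/
theorem hittingAfter_Ici_le_coe_iff (hmono : Monotone fun s ↦ E s ω)
    (hRC : ∀ T : ℝ≥0, (∀ n : ℕ, c ≤ E (T + 1 / ((n : ℝ≥0) + 1)) ω) → c ≤ E T ω) (t : ℝ≥0) :
    hittingAfter E (Set.Ici c) ⊥ ω ≤ (t : WithTop ℝ≥0) ↔ c ≤ E t ω := by
  constructor
  · intro h
    rw [hittingAfter_Ici_bot_apply] at h
    split_ifs at h with hex
    · have hne : {s | c ≤ E s ω}.Nonempty := hex
      have hinf : sInf {s | c ≤ E s ω} ≤ t := by exact_mod_cast h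
      by_contra hct
      refine hct (hRC t fun n ↦ ?_)
      have hlt : sInf {s | c ≤ E s ω} < t + 1 / ((n : ℝ≥0) + 1) :=
        hinf.trans_lt (lt_add_of_pos_right _ (by positivity))
      obtain ⟨s, hs, hst⟩ := exists_lt_of_csInf_lt hne hlt
      exact hs.trans (hmono hst.le)
    · exact absurd (top_le_iff.1 h) WithTop.coe_ne_top
  · intro h
    exact hittingAfter_le_of_mem bot_le (Set.mem_Ici.2 h)

/-- **At the hitting time the level is not exceeded**, for a family which is left-continuous
in time (in the form: `E r < c` for all `r < T` forces `E T ≤ c`). [folklore] -/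
theorem apply_le_of_hittingAfter_Ici_eq
    (hLC : ∀ T : ℝ≥0, (∀ r < T, E r ω < c) → E T ω ≤ c) {r : ℝ≥0}
    (h : hittingAfter E (Set.Ici c) ⊥ ω = r) : E r ω ≤ c := by
  rw [hittingAfter_Ici_bot_apply] at h
  split_ifs at h with hex
  · have hr : sInf {s | c ≤ E s ω} = r := by exact_mod_cast h
    refine hLC r fun r' hr' ↦ not_le.1 fun hmem ↦ ?_
    have := csInf_le (OrderBot.bddBelow {s | c ≤ E s ω}) hmem
    rw [hr] at this
    exact (not_lt.2 this) hr'
  · exact absurd h WithTop.top_ne_coe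

/-- The hitting times increase with the level (Mathlib's `hittingAfter_apply_anti`).
[folklore] -/
theorem hittingAfter_Ici_mono {c c' : ℝ≥0∞} (hcc' : c ≤ c') :
    hittingAfter E (Set.Ici c) ⊥ ω ≤ hittingAfter E (Set.Ici c') ⊥ ω :=
  hittingAfter_apply_anti E ⊥ ω (Set.Ici_subset_Ici.2 hcc')

/-- Before the level is reached at time `0`, the hitting time is positive. [folklore] -/
theorem bot_lt_hittingAfter_Ici (hmono : Monotone fun s ↦ E s ω)
    (hRC : ∀ T : ℝ≥0, (∀ n : ℕ, c ≤ E (T + 1 / ((n : ℝ≥0) + 1)) ω) → c ≤ E T ω)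
    (h0 : E 0 ω < c) : ⊥ < hittingAfter E (Set.Ici c) ⊥ ω := by
  rw [bot_lt_iff_ne_bot]
  intro h
  have : hittingAfter E (Set.Ici c) ⊥ ω ≤ ((0 : ℝ≥0) : WithTop ℝ≥0) := by rw [h]; exact bot_le
  exact (not_le.2 h0) ((hittingAfter_Ici_le_coe_iff hmono hRC 0).1 this)

/-- **Level-hitting times of an adapted right-continuous increasing family are stopping times
of the raw filtration** (`{T ≤ t} = {c ≤ E t}`; continuous-time companion of Mathlib's
`Adapted.isStoppingTime_hittingAfter`, which is for discrete time). [folklore] -/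
theorem isStoppingTime_hittingAfter_Ici (hmono : ∀ ω, Monotone fun s ↦ E s ω)
    (hRC : ∀ ω (T : ℝ≥0), (∀ n : ℕ, c ≤ E (T + 1 / ((n : ℝ≥0) + 1)) ω) → c ≤ E T ω)
    (hmeas : ∀ s, Measurable[𝓕 s] (E s)) : IsStoppingTime 𝓕 (hittingAfter E (Set.Ici c) ⊥) := by
  intro t
  have : {ω | hittingAfter E (Set.Ici c) ⊥ ω ≤ (t : WithTop ℝ≥0)} = {ω | c ≤ E t ω} := by
    ext ω; exact hittingAfter_Ici_le_coe_iff (hmono ω) (hRC ω) t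
  rw [this]
  exact measurableSet_le measurable_const (hmeas t)

end HitLevel


/-! ### Integrands cut at a stopping time -/

section CutIntegrand

/-- The integrand `G 𝟙_{[0, τ]}`: `G_s(ω)` for `s ≤ τ(ω)`, `0` after.
Revuz–Yor, *Continuous Martingales and Brownian Motion* (1999), Ch. IV, Prop. (2.10). [folklore] -/
def cutIntegrand (G : ℝ≥0 → Ω → ℝ) (τ : Ω → WithTop ℝ≥0) : ℝ≥0 → Ω → ℝ :=
  fun s ω ↦ {ω' | ((s : ℝ≥0) : WithTop ℝ≥0) ≤ τ ω'}.indicator (G s) ω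

/-- Up to the stopping time the cut integrand is the integrand. [folklore] -/
theorem cutIntegrand_of_le {G : ℝ≥0 → Ω → ℝ} {τ : Ω → WithTop ℝ≥0} {s : ℝ≥0} {ω : Ω}
    (h : ((s : ℝ≥0) : WithTop ℝ≥0) ≤ τ ω) : cutIntegrand G τ s ω = G s ω :=
  Set.indicator_of_mem (show ω ∈ {ω' | ((s : ℝ≥0) : WithTop ℝ≥0) ≤ τ ω'} from h) _

/-- After the stopping time the cut integrand vanishes. [folklore] -/
theorem cutIntegrand_of_lt {G : ℝ≥0 → Ω → ℝ} {τ : Ω → WithTop ℝ≥0} {s : ℝ≥0} {ω : Ω}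
    (h : τ ω < ((s : ℝ≥0) : WithTop ℝ≥0)) : cutIntegrand G τ s ω = 0 :=
  Set.indicator_of_notMem (show ω ∉ {ω' | ((s : ℝ≥0) : WithTop ℝ≥0) ≤ τ ω'} from not_le.2 h) _

/-- `s ≤ τ ω` iff the time `s` stopped at `τ` is still `s`. [folklore] -/
theorem coe_le_iff_untopA_min_eq {τ : Ω → WithTop ℝ≥0} (s : ℝ≥0) (ω : Ω) :
    ((s : ℝ≥0) : WithTop ℝ≥0) ≤ τ ω ↔ (min ((s : ℝ≥0) : WithTop ℝ≥0) (τ ω)).untopA = s := by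
  constructor
  · intro h
    rw [min_eq_left h, WithTop.untopA_eq_untop WithTop.coe_ne_top, WithTop.untop_coe]
  · intro h
    by_contra hlt
    push Not at hlt
    obtain ⟨r, hr⟩ := WithTop.ne_top_iff_exists.1 hlt.ne_top
    rw [← hr] at h hlt
    rw [min_eq_right hlt.le, WithTop.untopA_eq_untop WithTop.coe_ne_top, WithTop.untop_coe] at h
    subst h
    exact lt_irrefl _ hlt

/-- **An integrand cut at a stopping time of the raw filtration is progressive** when the
integrand is. [folklore] -/
theorem isStronglyProgressive_cutIntegrand {G : ℝ≥0 → Ω → ℝ} (hG : IsStronglyProgressive 𝓕 G)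
    {τ : Ω → WithTop ℝ≥0} (hτ : IsStoppingTime 𝓕 τ) :
    IsStronglyProgressive 𝓕 (cutIntegrand G τ) := by
  intro i
  have hmin := isStronglyProgressive_min_stopping_time hτ i
  have hfst : StronglyMeasurable[Subtype.instMeasurableSpace.prod (𝓕 i)]
      (fun p : Set.Iic i × Ω ↦ (p.1 : ℝ≥0)) :=
    (measurable_subtype_coe.comp (@measurable_fst (Set.Iic i) Ω _ (𝓕 i))).stronglyMeasurable
  have hset : MeasurableSet[Subtype.instMeasurableSpace.prod (𝓕 i)]
      {p : Set.Iic i × Ω | (((p.1 : ℝ≥0) : ℝ≥0) : WithTop ℝ≥0) ≤ τ p.2} := by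
    have heq : {p : Set.Iic i × Ω | (((p.1 : ℝ≥0) : ℝ≥0) : WithTop ℝ≥0) ≤ τ p.2} =
        {p : Set.Iic i × Ω | (min (((p.1 : ℝ≥0) : ℝ≥0) : WithTop ℝ≥0) (τ p.2)).untopA =
          (p.1 : ℝ≥0)} := by
      ext p; exact coe_le_iff_untopA_min_eq _ _
    rw [heq]
    exact hmin.measurableSet_eq_fun hfst
  have hfun : (fun p : Set.Iic i × Ω ↦ cutIntegrand G τ p.1 p.2) =
      {p : Set.Iic i × Ω | (((p.1 : ℝ≥0) : ℝ≥0) : WithTop ℝ≥0) ≤ τ p.2}.indicator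
        fun p ↦ G p.1 p.2 := by
    funext p
    classical
    simp only [cutIntegrand, Set.indicator_apply, Set.mem_setOf_eq]
  rw [hfun]
  exact (hG i).indicator hset

/-- **The sqEnergy of a cut integrand is the sqEnergy up to the stopping time**:
`∫₀ᵗ (G 𝟙_{[0,τ]})² ds ≤ ∫₀^{t ∧ τ} G² ds`. [folklore] -/
theorem sqEnergy_cutIntegrand_le (G : ℝ≥0 → Ω → ℝ) (τ : Ω → WithTop ℝ≥0) (t : ℝ≥0) (ω : Ω) :
    sqEnergy (cutIntegrand G τ) t ω ≤
      sqEnergy G ((min ((t : ℝ≥0) : WithTop ℝ≥0) (τ ω)).untopA) ω := by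
  set ρ := (min ((t : ℝ≥0) : WithTop ℝ≥0) (τ ω)).untopA with hρ
  have hne : min ((t : ℝ≥0) : WithTop ℝ≥0) (τ ω) ≠ ⊤ :=
    ne_top_of_le_ne_top WithTop.coe_ne_top (min_le_left _ _)
  unfold sqEnergy
  have hpt : ∀ r ∈ Set.Icc (0 : ℝ) t,
      ENNReal.ofReal (cutIntegrand G τ r.toNNReal ω ^ 2) ≤
        (Set.Icc (0 : ℝ) ρ).indicator (fun r ↦ ENNReal.ofReal (G r.toNNReal ω ^ 2)) r := by
    intro r hr
    by_cases h : ((r.toNNReal : ℝ≥0) : WithTop ℝ≥0) ≤ τ ω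
    · have hrρ : r.toNNReal ≤ ρ := by
        rw [hρ, WithTop.le_untopA_iff hne]
        exact le_min (by exact_mod_cast Real.toNNReal_le_iff_le_coe.2 hr.2) h
      have hmem : r ∈ Set.Icc (0 : ℝ) ρ := by
        refine ⟨hr.1, ?_⟩
        have : (r.toNNReal : ℝ) ≤ ρ := by exact_mod_cast hrρ
        rwa [Real.coe_toNNReal _ hr.1] at this
      rw [Set.indicator_of_mem hmem, cutIntegrand_of_le h]
    · rw [cutIntegrand_of_lt (not_le.1 h)]
      simp
  calc ∫⁻ r in Set.Icc (0 : ℝ) t, ENNReal.ofReal (cutIntegrand G τ r.toNNReal ω ^ 2)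
      ≤ ∫⁻ r in Set.Icc (0 : ℝ) t,
          (Set.Icc (0 : ℝ) ρ).indicator (fun r ↦ ENNReal.ofReal (G r.toNNReal ω ^ 2)) r :=
        setLIntegral_mono' measurableSet_Icc hpt
    _ = ∫⁻ r in Set.Icc (0 : ℝ) ρ ∩ Set.Icc (0 : ℝ) t, ENNReal.ofReal (G r.toNNReal ω ^ 2) := by
        rw [lintegral_indicator measurableSet_Icc, Measure.restrict_restrict measurableSet_Icc]
    _ ≤ ∫⁻ r in Set.Icc (0 : ℝ) ρ, ENNReal.ofReal (G r.toNNReal ω ^ 2) :=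
        lintegral_mono_set Set.inter_subset_left

/-- **Cut simple approximants approximate the cut integrand**: if `Lₖ → Ĥ` in `L²_loc(ds)` in
probability, `|Lₖ| ≤ Cₖ`, the capped cells of `Lₖ` in `[0, t]`, `t ≤ k`, have length `≤ δₖ`,
and `(Cₖ ∨ 0)² δₖ → 0`, then `Lₖ cut τ → Ĥ 𝟙_{[0,τ]}` in the same sense.
Revuz–Yor, *Continuous Martingales and Brownian Motion* (1999), Ch. IV, Prop. (2.10) and
Thm (2.12). [folklore] -/
theorem _root_.Literature.Probability.Process.SimpleProcess.isApproxSeq_cut {P : Measure Ω} {L : ℕ → Literature.Probability.Process.SimpleProcess m 𝓕}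
    {Hh : ℝ≥0 → Ω → ℝ} (hL : Literature.Probability.Process.SimpleProcess.IsApproxSeq L Hh P) (τ : Ω → WithTop ℝ≥0)
    (hτ : IsStoppingTime 𝓕 τ) {C δ : ℕ → ℝ} (hC : ∀ k i ω, |(L k).value i ω| ≤ C k)
    (hmesh : ∀ (k : ℕ) (t : ℝ≥0), t ≤ k → ∀ i, i + 1 < (L k).times.length →
      (((min t ((L k).time (i + 1))) : ℝ≥0) : ℝ) - (min t ((L k).time i) : ℝ≥0) ≤ δ k)
    (hCδ : Tendsto (fun k ↦ (max (C k) 0) ^ 2 * δ k) atTop (𝓝 0)) :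
    Literature.Probability.Process.SimpleProcess.IsApproxSeq (fun k ↦ (L k).cut τ hτ) (cutIntegrand Hh τ) P := by
  intro t ε hε
  rw [ENNReal.tendsto_nhds_zero]
  intro η hη
  have hε2 : 0 < ε / 2 := by positivity
  have hA := hL t (ε / 2) hε2
  rw [ENNReal.tendsto_nhds_zero] at hA
  have hsmall : ∀ᶠ k in atTop, (max (C k) 0) ^ 2 * δ k < ε / 2 :=
    hCδ.eventually (gt_mem_nhds hε2)
  have hlarge : ∀ᶠ k : ℕ in atTop, t ≤ k := by
    filter_upwards [eventually_ge_atTop ⌈(t : ℝ)⌉₊] with k hk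
    rw [← NNReal.coe_le_coe, NNReal.coe_natCast]
    exact (Nat.le_ceil _).trans (by exact_mod_cast hk)
  filter_upwards [hA η hη, hsmall, hlarge] with k hk hsk hlk
  refine le_trans (measure_mono fun ω hω ↦ ?_) hk
  simp only [Set.mem_setOf_eq] at hω ⊢
  by_contra hcon
  push Not at hcon
  have hle := (L k).lintegral_toProcess_cut_sub_sq_le τ hτ Hh (hC k) ω t (hmesh k t hlk)
  have hlt : (∫⁻ s in Set.Icc (0 : ℝ) t, ENNReal.ofReal (((L k).toProcess s.toNNReal ω -
      Hh s.toNNReal ω) ^ 2)) + ENNReal.ofReal ((max (C k) 0) ^ 2 * δ k) <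
      ENNReal.ofReal (ε / 2) + ENNReal.ofReal (ε / 2) :=
    ENNReal.add_lt_add hcon ((ENNReal.ofReal_lt_ofReal_iff hε2).2 hsk)
  rw [← ENNReal.ofReal_add hε2.le hε2.le, add_halves] at hlt
  exact (lt_irrefl _) ((hω.trans hle).trans_lt hlt)

end CutIntegrand

/-! ### Localisation on the canonical space -/

section Brownian

/-- Capped cells grow with the cap. [folklore] -/
theorem cappedCell_mono {a b t k : ℝ≥0} (hab : a ≤ b) (htk : t ≤ k) :
    ((min t b : ℝ≥0) : ℝ) - (min t a : ℝ≥0) ≤ (min k b : ℝ≥0) - (min k a : ℝ≥0) := by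
  rcases le_total t a with hta | hat
  · rw [min_eq_left hta, min_eq_left (hta.trans hab), sub_self]
    have : min k a ≤ min k b := min_le_min_left k hab
    have : ((min k a : ℝ≥0) : ℝ) ≤ (min k b : ℝ≥0) := by exact_mod_cast this
    linarith
  · rw [min_eq_right hat, min_eq_right (hat.trans htk)]
    have : min t b ≤ min k b := min_le_min_right b htk
    have : ((min t b : ℝ≥0) : ℝ) ≤ (min k b : ℝ≥0) := by exact_mod_cast this
    linarith

/-- **Diagonal choice of fine bounded simple approximants.** Given, for every `k`, some
approximating sequence of the integrand `G k` (on the canonical space), there are bounded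
simple processes `L k` with bounds `C k ≥ 0`, meshes `δ k > 0` on `[0, k]` and moduli `θ k > 0`
such that `Cₖ² δₖ ≤ 2⁻ᵏ`, `Cₖ θₖ ≤ 2⁻ᵏ`, the Brownian paths oscillate by more than `θₖ` over
`δₖ` on `[0, k]` only with probability `≤ 2⁻ᵏ`, and `∫₀ᵏ (Lₖ - Gₖ)² ≥ 2⁻ᵏ` only with
probability `≤ 2⁻ᵏ`.
Revuz–Yor, *Continuous Martingales and Brownian Motion* (1999), Ch. IV, §2 (subdivisions
"including the `tᵢ`'s", Prop. (2.13)). [folklore] -/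
theorem exists_diag_simpleProcess (G : ℕ → ℝ≥0 → (ℝ≥0 → ℝ) → ℝ)
    (hS : ∀ k, ∃ S : ℕ → Literature.Probability.Process.SimpleProcess (inferInstance : MeasurableSpace (ℝ≥0 → ℝ))
      Literature.Probability.RandomPlanarGeometry.brownianFiltration, Literature.Probability.Process.SimpleProcess.IsApproxSeq S (G k) Literature.Probability.Process.preWienerMeasure) :
    ∃ (L : ℕ → Literature.Probability.Process.SimpleProcess (inferInstance : MeasurableSpace (ℝ≥0 → ℝ)) Literature.Probability.RandomPlanarGeometry.brownianFiltration)
      (C δ θ : ℕ → ℝ),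
      (∀ k, 0 ≤ C k) ∧ (∀ k i ω, |(L k).value i ω| ≤ C k) ∧ (∀ k, 0 < δ k) ∧
      (∀ (k : ℕ) (t : ℝ≥0), t ≤ k → ∀ i, i + 1 < (L k).times.length →
        (((min t ((L k).time (i + 1))) : ℝ≥0) : ℝ) - (min t ((L k).time i) : ℝ≥0) ≤ δ k) ∧
      (∀ k, (C k) ^ 2 * δ k ≤ (1 / 2 : ℝ) ^ k) ∧ (∀ k, 0 < θ k) ∧
      (∀ k, C k * θ k ≤ (1 / 2 : ℝ) ^ k) ∧
      (∀ k : ℕ, Literature.Probability.Process.preWienerMeasure {ω | ∃ s ≤ ((k : ℕ) : ℝ≥0), ∃ s' ≤ ((k : ℕ) : ℝ≥0),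
        |(s : ℝ) - s'| ≤ δ k ∧ θ k < |Literature.Probability.Process.brownian s ω - Literature.Probability.Process.brownian s' ω|} ≤
          ENNReal.ofReal ((1 / 2 : ℝ) ^ k)) ∧
      (∀ k : ℕ, Literature.Probability.Process.preWienerMeasure {ω | ENNReal.ofReal ((1 / 2 : ℝ) ^ k) ≤
        ∫⁻ s in Set.Icc (0 : ℝ) ((k : ℕ) : ℝ≥0), ENNReal.ofReal (((L k).toProcess s.toNNReal ω -
          G k s.toNNReal ω) ^ 2)} ≤ ENNReal.ofReal ((1 / 2 : ℝ) ^ k)) := by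
  haveI := Literature.Probability.RandomPlanarGeometry.isProbabilityMeasure_preWienerMeasure'
  have hhalf : ∀ k : ℕ, (0 : ℝ) < (1 / 2 : ℝ) ^ k := fun k ↦ by positivity
  choose S hS using hS
  -- the diagonal index
  have hn : ∀ k : ℕ, ∃ n : ℕ, Literature.Probability.Process.preWienerMeasure {ω | ENNReal.ofReal ((1 / 2 : ℝ) ^ k) ≤
      ∫⁻ s in Set.Icc (0 : ℝ) ((k : ℕ) : ℝ≥0), ENNReal.ofReal (((S k n).toProcess s.toNNReal ω -
        G k s.toNNReal ω) ^ 2)} ≤ ENNReal.ofReal ((1 / 2 : ℝ) ^ k) := fun k ↦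
    ((ENNReal.tendsto_nhds_zero.1 (hS k k _ (hhalf k))) _
      (ENNReal.ofReal_pos.2 (hhalf k))).exists
  choose n hn using hn
  -- bounds
  choose C₀ hC₀ using fun k ↦ (S k (n k)).bounded
  set C : ℕ → ℝ := fun k ↦ max (C₀ k) 0 with hC
  have hC0 : ∀ k, 0 ≤ C k := fun k ↦ le_max_right _ _
  -- moduli
  set θ : ℕ → ℝ := fun k ↦ (1 / 2 : ℝ) ^ k / (C k + 1) with hθ
  have hθ0 : ∀ k, 0 < θ k := fun k ↦ div_pos (hhalf k) (by linarith [hC0 k])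
  have hCθ : ∀ k, C k * θ k ≤ (1 / 2 : ℝ) ^ k := by
    intro k
    rw [hθ, mul_div_assoc']
    rw [div_le_iff₀ (by linarith [hC0 k])]
    nlinarith [hC0 k, hhalf k]
  have hρ : ∀ k : ℕ, ∃ ρ > (0 : ℝ), Literature.Probability.Process.preWienerMeasure {ω | ∃ s ≤ ((k : ℕ) : ℝ≥0),
      ∃ s' ≤ ((k : ℕ) : ℝ≥0), |(s : ℝ) - s'| ≤ ρ ∧ θ k < |Literature.Probability.Process.brownian s ω - Literature.Probability.Process.brownian s' ω|} ≤
        ENNReal.ofReal ((1 / 2 : ℝ) ^ k) := fun k ↦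
    Literature.Probability.Process.exists_measure_modulus_gt_le (P := Literature.Probability.Process.preWienerMeasure) (fun s ↦ Literature.Probability.Process.measurable_brownian s)
      (ae_of_all _ Literature.Probability.Process.continuous_brownian) (k : ℝ≥0) (hθ0 k) (ENNReal.ofReal_pos.2 (hhalf k))
  choose ρ hρ0 hρ using hρ
  -- meshes
  set δ : ℕ → ℝ := fun k ↦ min (ρ k) ((1 / 2 : ℝ) ^ k / ((C k) ^ 2 + 1)) with hδ
  have hδ0 : ∀ k, 0 < δ k := fun k ↦ lt_min (hρ0 k) (div_pos (hhalf k) (by positivity))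
  have hCδ : ∀ k, (C k) ^ 2 * δ k ≤ (1 / 2 : ℝ) ^ k := by
    intro k
    calc (C k) ^ 2 * δ k ≤ (C k) ^ 2 * ((1 / 2 : ℝ) ^ k / ((C k) ^ 2 + 1)) :=
          mul_le_mul_of_nonneg_left (min_le_right _ _) (sq_nonneg _)
      _ = (C k) ^ 2 / ((C k) ^ 2 + 1) * (1 / 2 : ℝ) ^ k := by ring
      _ ≤ 1 * (1 / 2 : ℝ) ^ k := by
          gcongr
          rw [div_le_one (by positivity)]; linarith
      _ = (1 / 2 : ℝ) ^ k := one_mul _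
  -- refinement levels
  have hN : ∀ k : ℕ, ∃ N : ℕ, (k : ℝ) / 2 ^ N ≤ δ k := by
    intro k
    obtain ⟨N, hN⟩ := pow_unbounded_of_one_lt ((k : ℝ) / δ k) (one_lt_two (α := ℝ))
    refine ⟨N, ?_⟩
    rw [div_le_iff₀ (pow_pos two_pos N)]
    rw [div_lt_iff₀ (hδ0 k)] at hN
    linarith
  choose N hN using hN
  -- the diagonal sequence
  refine ⟨fun k ↦ (S k (n k)).gridRefine k (N k), C, δ, θ, hC0, ?_, hδ0, ?_, hCδ, hθ0, hCθ,
    ?_, ?_⟩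
  · intro k i ω
    exact (S k (n k)).abs_gridRefine_value_le k (N k) (hC₀ k) i ω
  · intro k t htk i hi
    set R := (S k (n k)).gridRefine k (N k)
    calc ((min t (R.time (i + 1)) : ℝ≥0) : ℝ) - (min t (R.time i) : ℝ≥0)
        ≤ (min (k : ℝ≥0) (R.time (i + 1)) : ℝ≥0) - (min (k : ℝ≥0) (R.time i) : ℝ≥0) :=
          cappedCell_mono (R.time_mono (Nat.le_succ i) hi) htk
      _ ≤ (k : ℝ≥0) / 2 ^ (N k) := (S k (n k)).gridRefine_cappedCell_le k (N k) hi
      _ = (k : ℝ) / 2 ^ (N k) := by norm_cast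
      _ ≤ δ k := hN k
  · intro k
    refine le_trans (measure_mono fun ω ↦ ?_) (hρ k)
    rintro ⟨s, hs, s', hs', hss', hθ'⟩
    exact ⟨s, hs, s', hs', hss'.trans (min_le_left _ _), hθ'⟩
  · intro k
    simp only [Literature.Probability.Process.SimpleProcess.toProcess_gridRefine]
    exact hn k

variable {H : ℝ≥0 → (ℝ≥0 → ℝ) → ℝ}

/-- **Values of a u.c.p. limit at bounded random times are limits in probability.** [folklore] -/
theorem _root_.Literature.Probability.Process.TendstoUCP.tendsto_measure_le_abs_sub {Ω : Type*} {mΩ : MeasurableSpace Ω} {P : Measure Ω}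
    {Y : ℕ → ℝ≥0 → Ω → ℝ} {J : ℝ≥0 → Ω → ℝ} (h : Literature.Probability.Process.TendstoUCP Y J P) (t : ℝ≥0)
    {ρ : Ω → ℝ≥0} (hρ : ∀ ω, ρ ω ≤ t) {ε : ℝ} (hε : 0 < ε) :
    Tendsto (fun k ↦ P {ω | ε ≤ |Y k (ρ ω) ω - J (ρ ω) ω|}) atTop (𝓝 0) :=
  tendsto_of_tendsto_of_tendsto_of_le_of_le tendsto_const_nhds (h t ε hε)
    (fun _ ↦ zero_le) fun _ ↦ measure_mono fun ω hω ↦ ⟨ρ ω, hρ ω, hω⟩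

/-- Two random variables which are `ε`-close outside a null set for every `ε > 0` are a.s.
equal. [folklore] -/
theorem ae_eq_of_forall_measure_le_abs_sub_eq_zero {Ω : Type*} {mΩ : MeasurableSpace Ω}
    {P : Measure Ω} {U V : Ω → ℝ} (h : ∀ ε : ℝ, 0 < ε → P {ω | ε ≤ |U ω - V ω|} = 0) :
    U =ᵐ[P] V := by
  have hsub : {ω | ¬ U ω = V ω} ⊆ ⋃ k : ℕ, {ω | 1 / ((k : ℝ) + 1) ≤ |U ω - V ω|} := by
    intro ω hω
    simp only [Set.mem_setOf_eq] at hω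
    have hpos : 0 < |U ω - V ω| := abs_pos.2 (sub_ne_zero.2 hω)
    obtain ⟨k, hk⟩ := exists_nat_one_div_lt hpos
    simp only [Set.mem_iUnion, Set.mem_setOf_eq]
    exact ⟨k, hk.le⟩
  rw [Filter.EventuallyEq, ae_iff]
  exact measure_mono_null hsub <| (measure_iUnion_null_iff).2 fun k ↦ h _ (by positivity)

/-- **The stopped u.c.p. limit is a modification of the integral of the cut integrand.** If
`(Lₖ · B) → J` and `((Lₖ cut τ) · B) → I` uniformly on compacts in probability, for fine bounded
`Lₖ` as in `exists_diag_simpleProcess`, then `J_{t ∧ τ} = I_t` almost surely: the two elementary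
integrals agree up to `τ`, and the cut one moves by at most `Cₖ θₖ ≤ 2⁻ᵏ` between `t ∧ τ` and `t`
outside the modulus event.
Revuz–Yor, *Continuous Martingales and Brownian Motion* (1999), Ch. IV, Prop. (2.10)
(`K 1_{[0,T]} · M = (K · M)^T`). [folklore] -/
theorem stoppedProcess_ae_eq_of_tendstoUCP
    {L : ℕ → Literature.Probability.Process.SimpleProcess (inferInstance : MeasurableSpace (ℝ≥0 → ℝ)) Literature.Probability.RandomPlanarGeometry.brownianFiltration}
    {C δ θ : ℕ → ℝ} (hC0 : ∀ k, 0 ≤ C k) (hC : ∀ k i ω, |(L k).value i ω| ≤ C k)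
    (hmesh : ∀ (k : ℕ) (t : ℝ≥0), t ≤ k → ∀ i, i + 1 < (L k).times.length →
      (((min t ((L k).time (i + 1))) : ℝ≥0) : ℝ) - (min t ((L k).time i) : ℝ≥0) ≤ δ k)
    (hθ0 : ∀ k, 0 < θ k) (hCθ : ∀ k, C k * θ k ≤ (1 / 2 : ℝ) ^ k)
    (hmod : ∀ k : ℕ, Literature.Probability.Process.preWienerMeasure {ω | ∃ s ≤ ((k : ℕ) : ℝ≥0), ∃ s' ≤ ((k : ℕ) : ℝ≥0),
      |(s : ℝ) - s'| ≤ δ k ∧ θ k < |Literature.Probability.Process.brownian s ω - Literature.Probability.Process.brownian s' ω|} ≤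
        ENNReal.ofReal ((1 / 2 : ℝ) ^ k))
    {τ : (ℝ≥0 → ℝ) → WithTop ℝ≥0} (hτ : IsStoppingTime Literature.Probability.RandomPlanarGeometry.brownianFiltration τ)
    {J I : ℝ≥0 → (ℝ≥0 → ℝ) → ℝ}
    (hJ : Literature.Probability.Process.TendstoUCP (fun k ↦ (L k).integral Literature.Probability.Process.brownian) J Literature.Probability.Process.preWienerMeasure)
    (hI : Literature.Probability.Process.TendstoUCP (fun k ↦ ((L k).cut τ hτ).integral Literature.Probability.Process.brownian) I Literature.Probability.Process.preWienerMeasure) (t : ℝ≥0) :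
    stoppedProcess J τ t =ᵐ[Literature.Probability.Process.preWienerMeasure] I t := by
  -- the stopped time
  set ρ : (ℝ≥0 → ℝ) → ℝ≥0 := fun ω ↦ (min ((t : ℝ≥0) : WithTop ℝ≥0) (τ ω)).untopA with hρ
  have hne : ∀ ω, min ((t : ℝ≥0) : WithTop ℝ≥0) (τ ω) ≠ ⊤ := fun ω ↦
    ne_top_of_le_ne_top WithTop.coe_ne_top (min_le_left _ _)
  have hρt : ∀ ω, ρ ω ≤ t := fun ω ↦ WithTop.untopA_le (min_le_left _ _)
  have hρτ : ∀ ω, ((ρ ω : ℝ≥0) : WithTop ℝ≥0) ≤ τ ω := fun ω ↦ by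
    rw [hρ]; dsimp only
    rw [WithTop.untopA_eq_untop (hne ω), WithTop.coe_untop]
    exact min_le_right _ _
  have hstop : stoppedProcess J τ t = fun ω ↦ J (ρ ω) ω := rfl
  rw [hstop]
  refine ae_eq_of_forall_measure_le_abs_sub_eq_zero fun ε hε ↦ ?_
  have hε3 : 0 < ε / 3 := by positivity
  -- the three small events
  have hA := Literature.Probability.Process.TendstoUCP.tendsto_measure_le_abs_sub hJ t hρt hε3
  have hCev := Literature.Probability.Process.TendstoUCP.tendsto_measure_le_abs_sub hI t (ρ := fun _ ↦ t) (fun _ ↦ le_rfl) hε3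
  have hB : Tendsto (fun k ↦ Literature.Probability.Process.preWienerMeasure {ω | ε / 3 ≤
      |((L k).cut τ hτ).integral Literature.Probability.Process.brownian (ρ ω) ω - ((L k).cut τ hτ).integral Literature.Probability.Process.brownian t ω|})
      atTop (𝓝 0) := by
    have hhalf : Tendsto (fun k : ℕ ↦ (1 / 2 : ℝ) ^ k) atTop (𝓝 0) :=
      tendsto_pow_atTop_nhds_zero_of_lt_one (by norm_num) (by norm_num)
    have hsmall : ∀ᶠ k : ℕ in atTop, (1 / 2 : ℝ) ^ k < ε / 3 := hhalf.eventually (gt_mem_nhds hε3)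
    have hlarge : ∀ᶠ k : ℕ in atTop, t ≤ k := by
      filter_upwards [eventually_ge_atTop ⌈(t : ℝ)⌉₊] with k hk
      rw [← NNReal.coe_le_coe, NNReal.coe_natCast]
      exact (Nat.le_ceil _).trans (by exact_mod_cast hk)
    have hlim : Tendsto (fun k : ℕ ↦ ENNReal.ofReal ((1 / 2 : ℝ) ^ k)) atTop (𝓝 0) := by
      rw [← ENNReal.ofReal_zero]
      exact ENNReal.tendsto_ofReal hhalf
    refine tendsto_of_tendsto_of_tendsto_of_le_of_le' tendsto_const_nhds hlim
      (Eventually.of_forall fun _ ↦ zero_le) ?_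
    filter_upwards [hsmall, hlarge] with k hsk hlk
    refine le_trans (measure_mono fun ω hω ↦ ?_) (hmod k)
    -- outside the modulus event the difference is `≤ C θ ≤ 2⁻ᵏ < ε/3`
    by_contra hgood
    simp only [Set.mem_setOf_eq, not_exists, not_and, not_lt] at hω hgood
    have hBpath : ∀ u ≤ t, ∀ v ≤ t, |(u : ℝ) - v| ≤ δ k →
        |Literature.Probability.Process.brownian u ω - Literature.Probability.Process.brownian v ω| ≤ θ k :=
      fun u hu v hv huv ↦ hgood u (hu.trans hlk) v (hv.trans hlk) huv
    have hdiff : |((L k).cut τ hτ).integral Literature.Probability.Process.brownian (ρ ω) ω -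
        ((L k).cut τ hτ).integral Literature.Probability.Process.brownian t ω| ≤ C k * θ k := by
      cases hτω : τ ω with
      | top =>
        have : ρ ω = t := by
          rw [hρ]; dsimp only; rw [hτω, min_eq_left le_top,
            WithTop.untopA_eq_untop WithTop.coe_ne_top, WithTop.untop_coe]
        rw [this, sub_self, abs_zero]
        exact mul_nonneg (hC0 k) (hθ0 k).le
      | coe r =>
        have : ρ ω = min t r := by
          rw [hρ]; dsimp only
          rw [hτω, ← WithTop.coe_min, WithTop.untopA_eq_untop WithTop.coe_ne_top,
            WithTop.untop_coe]
        rw [this, abs_sub_comm]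
        exact (L k).abs_integral_cut_sub_le τ hτ Literature.Probability.Process.brownian (hC k) (hC0 k) hτω t (hθ0 k).le
          (hmesh k t hlk) hBpath
    linarith [hCθ k]
  -- the triangle inequality on the events
  have hle : ∀ k, Literature.Probability.Process.preWienerMeasure {ω | ε ≤ |J (ρ ω) ω - I t ω|} ≤
      Literature.Probability.Process.preWienerMeasure {ω | ε / 3 ≤ |(L k).integral Literature.Probability.Process.brownian (ρ ω) ω - J (ρ ω) ω|} +
        Literature.Probability.Process.preWienerMeasure {ω | ε / 3 ≤ |((L k).cut τ hτ).integral Literature.Probability.Process.brownian (ρ ω) ω -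
          ((L k).cut τ hτ).integral Literature.Probability.Process.brownian t ω|} +
        Literature.Probability.Process.preWienerMeasure {ω | ε / 3 ≤ |((L k).cut τ hτ).integral Literature.Probability.Process.brownian t ω - I t ω|} := by
    intro k
    refine (measure_mono fun ω hω ↦ ?_).trans
      ((measure_union_le _ _).trans (add_le_add (measure_union_le _ _) le_rfl))
    simp only [Set.mem_union, Set.mem_setOf_eq] at hω ⊢
    by_contra hcon
    simp only [not_or, not_le] at hcon
    obtain ⟨⟨h1, h2⟩, h3⟩ := hcon
    have hcut : ((L k).cut τ hτ).integral Literature.Probability.Process.brownian (ρ ω) ω = (L k).integral Literature.Probability.Process.brownian (ρ ω) ω :=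
      (L k).integral_cut_of_le τ hτ Literature.Probability.Process.brownian (hρτ ω)
    rw [hcut] at h2
    have : |J (ρ ω) ω - I t ω| ≤ |(L k).integral Literature.Probability.Process.brownian (ρ ω) ω - J (ρ ω) ω| +
        |(L k).integral Literature.Probability.Process.brownian (ρ ω) ω - ((L k).cut τ hτ).integral Literature.Probability.Process.brownian t ω| +
        |((L k).cut τ hτ).integral Literature.Probability.Process.brownian t ω - I t ω| := by
      have e : J (ρ ω) ω - I t ω = -((L k).integral Literature.Probability.Process.brownian (ρ ω) ω - J (ρ ω) ω) +
          ((L k).integral Literature.Probability.Process.brownian (ρ ω) ω - ((L k).cut τ hτ).integral Literature.Probability.Process.brownian t ω) +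
          (((L k).cut τ hτ).integral Literature.Probability.Process.brownian t ω - I t ω) := by ring
      rw [e]
      refine (abs_add_le _ _).trans (add_le_add ((abs_add_le _ _).trans ?_) le_rfl)
      rw [abs_neg]
    linarith
  have hlim : Tendsto (fun k ↦
      Literature.Probability.Process.preWienerMeasure {ω | ε / 3 ≤ |(L k).integral Literature.Probability.Process.brownian (ρ ω) ω - J (ρ ω) ω|} +
        Literature.Probability.Process.preWienerMeasure {ω | ε / 3 ≤ |((L k).cut τ hτ).integral Literature.Probability.Process.brownian (ρ ω) ω -
          ((L k).cut τ hτ).integral Literature.Probability.Process.brownian t ω|} +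
        Literature.Probability.Process.preWienerMeasure {ω | ε / 3 ≤ |((L k).cut τ hτ).integral Literature.Probability.Process.brownian t ω - I t ω|})
      atTop (𝓝 0) := by
    simpa using (hA.add hB).add hCev
  exact le_antisymm (ge_of_tendsto hlim (Eventually.of_forall hle)) bot_le

/-- **Existence of the Itô integral of the finite-sqEnergy part** of a progressive integrand
against the canonical Brownian motion, for the raw Brownian filtration: localisation of the
square-integrable case (`exists_isItoIntegral_of_sq_integrable`) along the sqEnergy levels
`Tₘ = inf {t : ∫₀ᵗ Ĥ² ds ≥ m}` (stopping times of the raw filtration), with the (progressively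
regularised) u.c.p. limit of a diagonal sequence of elementary integrals as the integral and
`J^{Tₘ}` a modification of the square-integrable martingale `∫ Ĥ 𝟙_{[0,Tₘ]} dB`.
Revuz–Yor, *Continuous Martingales and Brownian Motion* (1999), Ch. IV, Def. (2.6) and
Prop. (2.7) (existence of `K·M` for `K ∈ L²_loc(M)` by localisation along
`Tₙ`), Prop. (2.10)(ii) (`(K·X)^T = (K 1_{[0,T]})·X`), Prop. (2.13).
[cite: RevuzYor1999, Ch. IV Prop. (2.7)] -/
theorem exists_isItoIntegral_finiteEnergyPart (hH : IsStronglyProgressive Literature.Probability.RandomPlanarGeometry.brownianFiltration H)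
    (hint : ∀ t : ℝ≥0, ∀ᵐ ω ∂Literature.Probability.Process.preWienerMeasure,
      IntegrableOn (fun s : ℝ ↦ H s.toNNReal ω ^ 2) (Set.Icc 0 t)) :
    ∃ J, IsStronglyProgressive Literature.Probability.RandomPlanarGeometry.brownianFiltration J ∧
      Literature.Probability.Process.IsItoIntegral (finiteEnergyPart H) Literature.Probability.Process.brownian J Literature.Probability.RandomPlanarGeometry.brownianFiltration Literature.Probability.Process.preWienerMeasure := by
  haveI := Literature.Probability.RandomPlanarGeometry.isProbabilityMeasure_preWienerMeasure'
  -- the finite-sqEnergy part and its sqEnergy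
  set Hh := finiteEnergyPart H with hHh
  have hHh_prog : IsStronglyProgressive Literature.Probability.RandomPlanarGeometry.brownianFiltration Hh :=
    isStronglyProgressive_finiteEnergyPart hH
  have hσ : ∀ᵐ ω ∂Literature.Probability.Process.preWienerMeasure, Measurable fun s : ℝ ↦ Hh s.toNNReal ω :=
    ae_of_all _ (Literature.Probability.Process.measurable_path_of_measurable_toNNReal
      (Literature.Probability.Process.measurable_toNNReal_of_isStronglyProgressive hHh_prog))
  set E' : ℝ≥0 → (ℝ≥0 → ℝ) → ℝ≥0∞ := sqEnergy Hh with hE'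
  have hmonoE : ∀ ω, Monotone fun s ↦ E' s ω := fun ω ↦ sqEnergy_mono Hh ω
  have hRC : ∀ (ω : ℝ≥0 → ℝ) (c : ℝ≥0∞) (T : ℝ≥0),
      (∀ n : ℕ, c ≤ E' (T + 1 / ((n : ℝ≥0) + 1)) ω) → c ≤ E' T ω := fun ω c T h ↦
    ge_of_tendsto' (tendsto_sqEnergy_finiteEnergyPart H ω T) h
  have hLC : ∀ (ω : ℝ≥0 → ℝ) (c : ℝ≥0∞) (T : ℝ≥0), (∀ r < T, E' r ω < c) → E' T ω ≤ c :=
    fun ω c T h ↦ sqEnergy_le_of_forall_lt Hh fun r hr ↦ (h r hr).le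
  have hmeasE : ∀ s, Measurable[Literature.Probability.RandomPlanarGeometry.brownianFiltration s] (E' s) := measurable_sqEnergy hHh_prog
  -- the sqEnergy levels
  set τ : ℕ → (ℝ≥0 → ℝ) → WithTop ℝ≥0 := fun m ↦ hittingAfter E' (Set.Ici (m : ℝ≥0∞)) ⊥
    with hτdef
  have hτ : ∀ m, IsStoppingTime Literature.Probability.RandomPlanarGeometry.brownianFiltration (τ m) := fun m ↦
    isStoppingTime_hittingAfter_Ici hmonoE (fun ω T h ↦ hRC ω _ T h) hmeasE
  have hbot : ∀ (n : ℕ) ω, ⊥ < τ (n + 1) ω := fun n ω ↦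
    bot_lt_hittingAfter_Ici (hmonoE ω) (fun T h ↦ hRC ω _ T h) (by
      show sqEnergy Hh 0 ω < ((n + 1 : ℕ) : ℝ≥0∞)
      rw [sqEnergy_zero]; exact_mod_cast Nat.succ_pos n)
  have hτmono : ∀ ω, Monotone fun m ↦ τ m ω := fun ω m m' hmm' ↦
    hittingAfter_Ici_mono (by exact_mod_cast hmm')
  have hτle : ∀ (m : ℕ) ω (t : ℝ≥0), τ m ω ≤ (t : WithTop ℝ≥0) ↔ (m : ℝ≥0∞) ≤ E' t ω :=
    fun m ω t ↦ hittingAfter_Ici_le_coe_iff (hmonoE ω) (fun T h ↦ hRC ω _ T h) t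
  -- the cut integrands and their square-integrable Itô integrals
  set G : ℕ → ℝ≥0 → (ℝ≥0 → ℝ) → ℝ := fun m ↦ cutIntegrand Hh (τ m) with hGdef
  have hG : ∀ m, IsStronglyProgressive Literature.Probability.RandomPlanarGeometry.brownianFiltration (G m) := fun m ↦
    isStronglyProgressive_cutIntegrand hHh_prog (hτ m)
  have henergyG : ∀ m (t : ℝ≥0) ω, sqEnergy (G m) t ω ≤ (m : ℝ≥0∞) := by
    intro m t ω
    refine (sqEnergy_cutIntegrand_le Hh (τ m) t ω).trans ?_
    cases hτω : τ m ω with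
    | top =>
      rw [min_eq_left le_top, WithTop.untopA_eq_untop WithTop.coe_ne_top, WithTop.untop_coe]
      refine le_of_lt (not_le.1 fun hle ↦ ?_)
      have := (hτle m ω t).2 hle
      rw [hτω] at this
      exact WithTop.coe_ne_top (top_le_iff.1 this)
    | coe r =>
      rw [← WithTop.coe_min, WithTop.untopA_eq_untop WithTop.coe_ne_top, WithTop.untop_coe]
      exact (hmonoE ω (min_le_right t r)).trans (apply_le_of_hittingAfter_Ici_eq (hLC ω _) hτω)
  have hfinG : ∀ m (t : ℝ≥0), ∫⁻ ω, (∫⁻ s in Set.Icc (0 : ℝ) t,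
      ENNReal.ofReal (G m s.toNNReal ω ^ 2)) ∂Literature.Probability.Process.preWienerMeasure ≠ ∞ := by
    intro m t
    refine ne_top_of_le_ne_top (b := ∫⁻ _, (m : ℝ≥0∞) ∂Literature.Probability.Process.preWienerMeasure) ?_ ?_
    · rw [lintegral_const, measure_univ, mul_one]; exact ENNReal.natCast_ne_top m
    · exact lintegral_mono fun ω ↦ henergyG m t ω
  choose I hI using fun m ↦ Literature.Probability.Process.exists_isItoIntegral_of_sq_integrable (hG m) (hfinG m)
  -- the diagonal sequence of fine bounded simple approximants
  obtain ⟨L, C, δ, θ, hC0, hC, hδ0, hmesh, hCδ, hθ0, hCθ, hmod, hLG⟩ :=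
    exists_diag_simpleProcess G fun k ↦ (hI k).1.2.2.2.1
  have hhalf : Tendsto (fun k : ℕ ↦ (1 / 2 : ℝ) ^ k) atTop (𝓝 0) :=
    tendsto_pow_atTop_nhds_zero_of_lt_one (by norm_num) (by norm_num)
  have hhalf' : Tendsto (fun k : ℕ ↦ ENNReal.ofReal ((1 / 2 : ℝ) ^ k)) atTop (𝓝 0) := by
    rw [← ENNReal.ofReal_zero]; exact ENNReal.tendsto_ofReal hhalf
  -- almost every path has locally finite sqEnergy: there `Ĥ = H` and `Tₘ ↑ ∞`
  have hgood : ∀ᵐ ω ∂Literature.Probability.Process.preWienerMeasure, ∀ n : ℕ, sqEnergy H n ω < ∞ :=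
    ae_forall_sqEnergy_lt_top hint
  have hτtop : ∀ᵐ ω ∂Literature.Probability.Process.preWienerMeasure, Tendsto (fun m ↦ τ m ω) atTop (𝓝 ⊤) := by
    filter_upwards [hgood] with ω hω
    have hE : ∀ s, E' s ω = sqEnergy H s ω := fun s ↦
      sqEnergy_congr (fun s ↦ finiteEnergyPart_eq_of_forall H hω s) s
    refine tendsto_order.2 ⟨fun a ha ↦ ?_, fun a ha ↦ absurd ha not_top_lt⟩
    obtain ⟨t, rfl⟩ := WithTop.ne_top_iff_exists.1 ha.ne
    obtain ⟨M, hM⟩ := ENNReal.exists_nat_gt (hω (⌈(t : ℝ)⌉₊ + 1)).ne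
    filter_upwards [eventually_ge_atTop M] with m hm
    refine not_le.1 fun hle ↦ ?_
    have h1 := (hτle m ω t).1 hle
    have h2 : E' t ω ≤ sqEnergy H ((⌈(t : ℝ)⌉₊ + 1 : ℕ) : ℝ≥0) ω := by
      rw [hE]
      refine sqEnergy_mono H ω ?_
      rw [← NNReal.coe_le_coe]; push_cast
      linarith [Nat.le_ceil (t : ℝ)]
    have h3 : (M : ℝ≥0∞) ≤ m := by exact_mod_cast hm
    exact (lt_irrefl _) ((h3.trans (h1.trans h2)).trans_lt hM)
  have hτlt : ∀ t : ℝ≥0, Tendsto (fun k ↦ Literature.Probability.Process.preWienerMeasure {ω | τ k ω < (t : WithTop ℝ≥0)})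
      atTop (𝓝 0) := by
    intro t
    refine Literature.Probability.Process.tendsto_measure_of_ae_eventually_notMem (fun k ↦ ?_) ?_
    · exact Literature.Probability.RandomPlanarGeometry.brownianFiltration.le t _ ((hτ k).measurableSet_lt t)
    · filter_upwards [hτtop] with ω hω
      have := (tendsto_order.1 hω).1 (t : WithTop ℝ≥0) (WithTop.coe_lt_top t)
      exact this.mono fun k hk h ↦ (lt_asymm hk) h
  -- `L` approximates `Ĥ`
  have hLapprox : Literature.Probability.Process.SimpleProcess.IsApproxSeq L Hh Literature.Probability.Process.preWienerMeasure := by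
    intro t ε hε
    rw [ENNReal.tendsto_nhds_zero]
    intro η hη
    have hη2 : 0 < η / 2 := ENNReal.half_pos hη.ne'
    have h1 := hτlt t
    have h2 := hhalf'
    rw [ENNReal.tendsto_nhds_zero] at h1 h2
    have hlarge : ∀ᶠ k : ℕ in atTop, t ≤ k := by
      filter_upwards [eventually_ge_atTop ⌈(t : ℝ)⌉₊] with k hk
      rw [← NNReal.coe_le_coe, NNReal.coe_natCast]
      exact (Nat.le_ceil _).trans (by exact_mod_cast hk)
    have hεk : ∀ᶠ k : ℕ in atTop, (1 / 2 : ℝ) ^ k ≤ ε := hhalf.eventually (ge_mem_nhds hε)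
    filter_upwards [h1 _ hη2, h2 _ hη2, hlarge, hεk] with k hk1 hk2 hk3 hk4
    -- split along `{T_k < t}`; on the complement `G k = Ĥ` on `[0, t]`
    have hsub : {ω | ENNReal.ofReal ε ≤ ∫⁻ s in Set.Icc (0 : ℝ) t,
        ENNReal.ofReal (((L k).toProcess s.toNNReal ω - Hh s.toNNReal ω) ^ 2)} ⊆
        {ω | τ k ω < (t : WithTop ℝ≥0)} ∪ {ω | ENNReal.ofReal ((1 / 2 : ℝ) ^ k) ≤
          ∫⁻ s in Set.Icc (0 : ℝ) ((k : ℕ) : ℝ≥0),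
            ENNReal.ofReal (((L k).toProcess s.toNNReal ω - G k s.toNNReal ω) ^ 2)} := by
      intro ω hω
      simp only [Set.mem_setOf_eq, Set.mem_union] at hω ⊢
      by_cases hτt : τ k ω < (t : WithTop ℝ≥0)
      · exact Or.inl hτt
      · right
        have hτt' : ((t : ℝ≥0) : WithTop ℝ≥0) ≤ τ k ω := not_lt.1 hτt
        have heq : ∫⁻ s in Set.Icc (0 : ℝ) t,
            ENNReal.ofReal (((L k).toProcess s.toNNReal ω - Hh s.toNNReal ω) ^ 2) =
            ∫⁻ s in Set.Icc (0 : ℝ) t,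
              ENNReal.ofReal (((L k).toProcess s.toNNReal ω - G k s.toNNReal ω) ^ 2) := by
          refine setLIntegral_congr_fun measurableSet_Icc fun s hs ↦ ?_
          have hst : ((s.toNNReal : ℝ≥0) : WithTop ℝ≥0) ≤ τ k ω :=
            le_trans (by exact_mod_cast Real.toNNReal_le_iff_le_coe.2 hs.2) hτt'
          simp only [hGdef, cutIntegrand_of_le hst]
        calc ENNReal.ofReal ((1 / 2 : ℝ) ^ k) ≤ ENNReal.ofReal ε := ENNReal.ofReal_le_ofReal hk4
          _ ≤ _ := hω
          _ = _ := heq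
          _ ≤ _ := lintegral_mono_set (Set.Icc_subset_Icc le_rfl (by exact_mod_cast hk3))
    refine (measure_mono hsub).trans ((measure_union_le _ _).trans ?_)
    calc _ ≤ η / 2 + η / 2 := add_le_add hk1 ((hLG k).trans hk2)
      _ = η := ENNReal.add_halves η
  -- the elementary integrals `Lₖ · B` are Cauchy uniformly on compacts in probability
  set Y : ℕ → ℝ≥0 → (ℝ≥0 → ℝ) → ℝ := fun k ↦ (L k).integral Literature.Probability.Process.brownian with hYdef
  have hYad : ∀ k, StronglyAdapted Literature.Probability.RandomPlanarGeometry.brownianFiltration (Y k) := fun k ↦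
    (Literature.Probability.Process.martingale_integral_brownian (L k)).stronglyAdapted
  have hYc : ∀ k ω, Continuous (Y k · ω) := fun k ω ↦
    (L k).continuous_integral (Literature.Probability.Process.continuous_brownian ω)
  have hcauchy : ∀ (t : ℝ≥0) (ε : ℝ), 0 < ε → ∀ η : ℝ≥0∞, 0 < η →
      ∃ N, ∀ k ≥ N, ∀ k' ≥ N,
        Literature.Probability.Process.preWienerMeasure {ω | ∃ s ≤ t, ε ≤ |Y k s ω - Y k' s ω|} ≤ η := by
    intro t ε hε η hη
    set η3 : ℝ≥0∞ := η / 3 with hη3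
    have hη3pos : 0 < η3 := ENNReal.div_pos hη.ne' ENNReal.ofNat_ne_top
    obtain ⟨κ, hκ, hκη⟩ : ∃ κ : ℝ, 0 < κ ∧ ENNReal.ofReal (κ / ε ^ 2) ≤ η3 := by
      by_cases htop : η3 = ⊤
      · exact ⟨1, one_pos, htop ▸ le_top⟩
      · refine ⟨η3.toReal * ε ^ 2, ?_, ?_⟩
        · have : 0 < η3.toReal := ENNReal.toReal_pos hη3pos.ne' htop
          positivity
        · rw [mul_div_assoc, div_self (by positivity), mul_one, ENNReal.ofReal_toReal htop]
    have hA := hLapprox t (κ / 4) (by positivity)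
    rw [ENNReal.tendsto_nhds_zero] at hA
    obtain ⟨N, hN⟩ := eventually_atTop.1 (hA η3 hη3pos)
    refine ⟨N, fun k hk k' hk' ↦ ?_⟩
    calc Literature.Probability.Process.preWienerMeasure {ω | ∃ s ≤ t, ε ≤ |Y k s ω - Y k' s ω|}
        ≤ _ := Literature.Probability.Process.measure_sup_integral_sub_ge_le_brownian (L k) (L k') hσ hε hκ t
      _ ≤ η3 + η3 + η3 := add_le_add (add_le_add (hN k hk) (hN k' hk')) hκη
      _ = η := ENNReal.add_thirds η
  obtain ⟨J₀, hJ₀a, hJ₀c, hJ₀0, hJ₀ucp, -⟩ := Literature.Probability.Process.exists_tendstoUCP_of_cauchy hYad hYc hcauchy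
  -- the integral: a progressive version of the u.c.p. limit
  set J := dyadicReg J₀ with hJdef
  have hJprog : IsStronglyProgressive Literature.Probability.RandomPlanarGeometry.brownianFiltration J :=
    isStronglyProgressive_dyadicReg hJ₀a.adapted
  have hJeq : ∀ᵐ ω ∂Literature.Probability.Process.preWienerMeasure, ∀ s, J s ω = J₀ s ω :=
    hJ₀c.mono fun ω hω s ↦ dyadicReg_apply_of_continuous hω s
  have hJ0 : ∀ ω, J 0 ω = 0 := by
    intro ω
    have h1 : J 0 ω = J₀ 0 ω := by
      show limUnder atTop (fun n : ℕ ↦ J₀ (dyadicFloor n 0) ω) = J₀ 0 ω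
      have : ∀ n : ℕ, dyadicFloor n 0 = 0 := fun n ↦ by simp [dyadicFloor]
      simp_rw [this]
      exact tendsto_const_nhds.limUnder_eq
    rw [h1]
    exact hJ₀0 ω fun k ↦ (L k).integral_zero Literature.Probability.Process.brownian ω
  have hJc : ∀ᵐ ω ∂Literature.Probability.Process.preWienerMeasure, Continuous (J · ω) := by
    filter_upwards [hJ₀c, hJeq] with ω h1 h2
    have : (J · ω) = (J₀ · ω) := funext h2
    rw [this]; exact h1
  have hJucp : Literature.Probability.Process.TendstoUCP Y J Literature.Probability.Process.preWienerMeasure := by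
    intro t ε hε
    refine (hJ₀ucp t ε hε).congr' (Eventually.of_forall fun k ↦ measure_congr ?_)
    filter_upwards [hJeq] with ω hω
    show (∃ s ≤ t, ε ≤ |Y k s ω - J₀ s ω|) = (∃ s ≤ t, ε ≤ |Y k s ω - J s ω|)
    simp only [hω]
  -- the cut approximants and the stopped integral
  have hCδ' : Tendsto (fun k ↦ (max (C k) 0) ^ 2 * δ k) atTop (𝓝 0) := by
    have heq : ∀ k, (max (C k) 0) ^ 2 * δ k = (C k) ^ 2 * δ k := fun k ↦ by
      rw [max_eq_left (hC0 k)]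
    simp_rw [heq]
    exact squeeze_zero (fun k ↦ mul_nonneg (sq_nonneg _) (hδ0 k).le) hCδ hhalf
  have hcutApprox : ∀ m, Literature.Probability.Process.SimpleProcess.IsApproxSeq (fun k ↦ (L k).cut (τ m) (hτ m)) (G m)
      Literature.Probability.Process.preWienerMeasure := fun m ↦
    Literature.Probability.Process.SimpleProcess.isApproxSeq_cut hLapprox (τ m) (hτ m) hC hmesh hCδ'
  have hIucp : ∀ m, Literature.Probability.Process.TendstoUCP (fun k ↦ ((L k).cut (τ m) (hτ m)).integral Literature.Probability.Process.brownian) (I m)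
      Literature.Probability.Process.preWienerMeasure := fun m ↦ (hI m).1.2.2.2.2 _ (hcutApprox m)
  have hYI : ∀ (m : ℕ) (t : ℝ≥0), stoppedProcess J (τ m) t =ᵐ[Literature.Probability.Process.preWienerMeasure] I m t :=
    fun m t ↦ stoppedProcess_ae_eq_of_tendstoUCP hC0 hC hmesh hθ0 hCθ hmod (hτ m) hJucp
      (hIucp m) t
  -- `J` is a local martingale along the sqEnergy levels
  have hlocal : Literature.Probability.RandomPlanarGeometry.IsLocalMartingale J Literature.Probability.RandomPlanarGeometry.brownianFiltration Literature.Probability.Process.preWienerMeasure := by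
    refine ⟨fun n ↦ τ (n + 1), ⟨⟨fun n ↦ hτ (n + 1), ?_⟩, ?_⟩, fun n ↦ ?_⟩
    · exact hτtop.mono fun ω hω ↦ hω.comp (tendsto_add_atTop_nat 1)
    · exact ae_of_all _ fun ω m m' hmm' ↦ hτmono ω (Nat.succ_le_succ hmm')
    · have hind : (fun i ↦ {ω | ⊥ < τ (n + 1) ω}.indicator (J i)) = J := by
        funext i ω
        exact Set.indicator_of_mem (show ω ∈ {ω | ⊥ < τ (n + 1) ω} from hbot n ω) _
      rw [hind]
      refine ⟨hJprog.stronglyAdapted_stoppedProcess (hτ (n + 1)), fun i j hij ↦ ?_⟩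
      exact (condExp_congr_ae (hYI (n + 1) j)).trans
        (((hI (n + 1)).2.1.condExp_ae_eq hij).trans (hYI (n + 1) i).symm)
  refine ⟨J, hJprog, hJ0, hJc, hlocal, ⟨L, hLapprox⟩, fun Hn hHn ↦ ?_⟩
  exact Literature.Probability.Process.tendstoUCP_of_isApproxSeq_brownian hσ hLapprox hHn hJucp

/-- **Existence of the Itô integral** (discharge of the named fact `Literature.Probability.Process.exists_isItoIntegral` of
`ItoCalculus.lean`): every integrand which is progressively measurable for the raw Brownian
filtration with `∫₀ᵗ H² ds < ∞` a.s. for every `t` has an Itô integral against the canonical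
Brownian motion in the sense of `Literature.Probability.Process.IsItoIntegral` — the integral of its finite-sqEnergy part,
which is the same integrand on almost every path.
Itô (1944); Revuz–Yor, *Continuous Martingales and Brownian Motion* (1999), Ch. IV, Thm (2.2),
Def. (2.6) and Prop. (2.7) (p. 130–131: `K ∈ L²_loc(M)` iff `∫₀ᵗ K² d⟨M,M⟩ < ∞` for every `t`;
existence and uniqueness of the continuous local martingale `K·M`), Prop. (2.10)(ii), Prop. (2.13).
[cite: RevuzYor1999, Ch. IV Prop. (2.7)] -/
theorem exists_isItoIntegral_holds : Literature.Probability.Process.exists_isItoIntegral := by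
  intro H hH hint
  obtain ⟨J, -, hJ⟩ := exists_isItoIntegral_finiteEnergyPart hH hint
  exact ⟨J, hJ.congr_integrand_ae ((ae_forall_sqEnergy_lt_top hint).mono
    fun ω hω s ↦ finiteEnergyPart_eq_of_forall H hω s)⟩

end Brownian

end Literature.Analysis.FunctionSpaces
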